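import Literature.NumberTheory.GaloisRepresentations.LAdicCharacterAnalyticExpansionProofs
import Literature.NumberTheory.GaloisRepresentations.WeakAbelianDirectSummandRatLocAlgProofs
import Literature.NumberTheory.GaloisRepresentations.WeakAbelianDirectSummandOfThm22Proofs
import Mathlib.FieldTheory.Galois.Basic
import HarnessLib

/-!
# Böckle–Hui Thm. 2.2 over quadratic fields, and Thm. 1.1 (characters) for quadratic `K` (proved)

Topic `NumberTheory/GaloisRepresentations`; namespace
`Literature.NumberTheory.GaloisRepresentations`.  A *proofs* file (theorems only; no definition,
no named fact, no instance).

**Theorem** (`Quadratic.pow_isLocallyAlgebraic_of_frobenius_isAlgebraic_quadratic`).  The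
hypothesis `h22` of `exists_heckeCharacter_of_weaklyDivides_of_thm22` — Böckle–Hui's Thm. 2.2
(Waldschmidt/Henniart: an `ℓ`-adic character with algebraic Frobenius values is almost locally
algebraic) in the tree's idelic rendering — HOLDS for every quadratic number field `K`
(`[K : ℚ] = 2`, `Algebra.IsQuadraticExtension ℚ K`).  Hence
(`exists_heckeCharacter_of_weaklyDivides_quadratic`) Böckle–Hui's Thm. 1.1 for characters, in the
Hecke form of the named fact `exists_heckeCharacter_of_weaklyDivides`, holds UNCONDITIONALLY over
quadratic fields (in particular over imaginary quadratic fields).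

This is the quadratic case of Serre's theorem (*Abelian ℓ-adic representations*, Ch. III §3.4:
"`K` a composite of quadratic extensions of `ℚ`"), whose transcendence input is only the
(`ℓ`-adic) six exponentials theorem: with `Gal(K/ℚ) = {1, c}`, the two `±1`-eigendirections of
`c` on `K ⊗ ℚ_ℓ` are realised by GLOBAL one-parameter families — the rationals `q = k c(k)` and the
anti-invariant elements `k / c(k)` — along each of which the analytic expansion
(`Expansion.exists_expansion`: `ι f(k) = exp(∑_τ λ_τ L(ι τ k))`, `ι τ₀ k = exp(∑_τ μ_{τ₀,τ} L(ι τ k))`)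
collapses to one variable, so the six exponentials theorem applies as in the case `K = ℚ`
(`PadicCharacterLocallyAlgebraicProofs`); and `k² = (k c k) · (k / c k)`.

## Contents

* B0 `not_linearIndependent_of_exp_isAlgebraic` — the six exponentials theorem in rescaled
  one-variable form; `exp_zpow_mul_exp_zpow_eq_one`.
* B1 quadratic fields: `exists_aut` (`Gal = {1, c}`, `c² = 1`), `univ_eq_pair` (the embeddings
  are `τ₁, τ₁ ∘ c`), `exists_algebraMap_eq_mul_aut` (`k c(k) ∈ ℚ`), transport of congruences.
* B2 `exists_test_elements` — three test elements `1 + C₀ x_j` supported on degree-one primes not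
  stable under `c` (such primes have density one: a `c`-stable degree-one prime divides
  `x₀ - c x₀`), by the Chinese remainder theorem.
* B3 `rational_line`, B4 `anti_line` — the two applications of the six exponentials theorem.
* B5 the theorem and the corollary.

## References

* J.-P. Serre, *Abelian ℓ-adic representations and elliptic curves* (1968), Ch. III §3.
  [SerreAbelianLadic1968]
* S. Lang, *Introduction to transcendental numbers* (1966), Ch. II §1. [Lang1966]
* G. Böckle, C.-Y. Hui, Math. Ann. 393 (2025), Thm. 1.1, Thm. 2.2. [BockleHui2025]
-/

noncomputable section

open scoped NumberField
open NumberField IsDedekindDomain IsDedekindDomain.HeightOneSpectrum Filter Topology Finset NormedSpace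
open Literature.NumberTheory.Transcendental

namespace Literature.NumberTheory.GaloisRepresentations

namespace Quadratic

/-! ### B0. The one-variable consequence of the six exponentials theorem -/

section SixExp

variable {ℓ : ℕ} [Fact ℓ.Prime] {E : Type} [NontriviallyNormedField E] [NormedAlgebra ℚ_[ℓ] E]
  [IsUltrametricDist E] [CompleteSpace E]

/-- **Six exponentials, rescaled form.**  If for every depth `t` there are three `ℤ`-independent
`y_j ∈ E` of norm `≤ ℓ^{-(t+1)}` with all `exp(x_i y_j)` algebraic, then `x₁, x₂` are
`ℤ`-dependent (rescale `x ↦ ℓ^t x`, `y ↦ ℓ^{-t} y` into the unit-free normalisation of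
`SixExpPadic.six_exponentials_padic`). [cite: Lang1966, Ch. II §1 Thm. 1, §2] -/
theorem not_linearIndependent_of_exp_isAlgebraic (x : Fin 2 → E)
    (h : ∀ t : ℕ, ∃ y : Fin 3 → E, LinearIndependent ℤ y ∧
      (∀ j, ‖y j‖ ≤ ((ℓ : ℝ)⁻¹) ^ (t + 1)) ∧ ∀ i j, IsAlgebraic ℤ (exp (x i * y j))) :
    ¬ LinearIndependent ℤ x := by
  intro hx
  have hp : ℓ.Prime := Fact.out
  have hℓ1 : (1 : ℝ) < ℓ := by exact_mod_cast hp.one_lt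
  have hℓ0 : (0 : ℝ) < ℓ := by positivity
  have hℓE : (ℓ : E) ≠ 0 := fun h0 => by
    have := PadicExp.norm_natCast_prime (ℓ := ℓ) (E := E)
    rw [h0, norm_zero] at this
    exact (inv_pos.mpr hℓ0).ne this
  -- the depth `t`: `‖x i‖ ℓ^{-t} ≤ ℓ⁻¹` for both `i`
  obtain ⟨t, ht⟩ : ∃ t : ℕ, ∀ i, ‖x i‖ * ((ℓ : ℝ)⁻¹) ^ t ≤ (ℓ : ℝ)⁻¹ := by
    obtain ⟨t, ht⟩ := pow_unbounded_of_one_lt (ℓ * max ‖x 0‖ ‖x 1‖) hℓ1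
    refine ⟨t, fun i => ?_⟩
    have hxi : ‖x i‖ ≤ max ‖x 0‖ ‖x 1‖ := by
      fin_cases i
      · exact le_max_left _ _
      · exact le_max_right _ _
    have h1 : (ℓ : ℝ) * ‖x i‖ ≤ (ℓ : ℝ) ^ t :=
      ((mul_le_mul_of_nonneg_left hxi hℓ0.le).trans ht.le)
    calc ‖x i‖ * ((ℓ : ℝ)⁻¹) ^ t = ((ℓ : ℝ) * ‖x i‖) * (((ℓ : ℝ)⁻¹) ^ t * (ℓ : ℝ)⁻¹) := by
          field_simp
      _ ≤ (ℓ : ℝ) ^ t * (((ℓ : ℝ)⁻¹) ^ t * (ℓ : ℝ)⁻¹) := by gcongr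
      _ = (ℓ : ℝ)⁻¹ := by
          rw [← mul_assoc, ← mul_pow, mul_inv_cancel₀ hℓ0.ne', one_pow, one_mul]
  obtain ⟨y, hy, hyn, halg⟩ := h t
  -- rescaled data
  set π : E := (ℓ : E) ^ t with hπ
  have hπ0 : π ≠ 0 := pow_ne_zero _ hℓE
  have hπn : ‖π‖ = ((ℓ : ℝ)⁻¹) ^ t := Expansion.norm_ell_pow (ℓ := ℓ) t
  set X : Fin 2 → E := fun i => π * x i with hX
  set Y : Fin 3 → E := fun j => π⁻¹ * y j with hY
  have hXY : ∀ i j, X i * Y j = x i * y j := by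
    intro i j; simp only [hX, hY]; field_simp
  have hXn : ∀ i, ‖X i‖ ≤ (ℓ : ℝ)⁻¹ := fun i => by
    rw [hX, norm_mul, hπn, mul_comm]; exact ht i
  have hYn : ∀ j, ‖Y j‖ ≤ (ℓ : ℝ)⁻¹ := fun j => by
    rw [hY, norm_mul, norm_inv, hπn]
    have hpos : (0 : ℝ) < ((ℓ : ℝ)⁻¹) ^ t := pow_pos (inv_pos.mpr hℓ0) t
    rw [inv_mul_le_iff₀ hpos, ← pow_succ]
    exact hyn j
  have hXli : LinearIndependent ℤ X := by
    rw [show X = ![π * x 0, π * x 1] by funext i; fin_cases i <;> simp [hX],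
      LinearIndependent.pair_iff]
    have hx' := hx
    rw [show x = ![x 0, x 1] by funext i; fin_cases i <;> simp, LinearIndependent.pair_iff] at hx'
    intro a b hrel
    refine hx' a b ?_
    have e : a • (π * x 0) + b • (π * x 1) = π * (a • x 0 + b • x 1) := by
      simp only [zsmul_eq_mul]; ring
    rw [e] at hrel
    exact (mul_eq_zero.mp hrel).resolve_left hπ0
  have hYli : LinearIndependent ℤ Y := by
    rw [Fintype.linearIndependent_iff] at hy ⊢
    intro g hg j
    refine hy g ?_ j
    have e : ∑ j, g j • Y j = π⁻¹ * ∑ j, g j • y j := by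
      rw [Finset.mul_sum]
      refine Finset.sum_congr rfl fun j _ => ?_
      simp only [hY, zsmul_eq_mul]; ring
    rw [e] at hg
    exact (mul_eq_zero.mp hg).resolve_left (inv_ne_zero hπ0)
  have halg6 : ∀ i j, IsAlgebraic ℤ (exp (X i * Y j)) := fun i j => by rw [hXY]; exact halg i j
  exact SixExpPadic.six_exponentials_padic X Y hXli hYli hXn hYn halg6

omit [IsUltrametricDist E] in
/-- From a `ℤ`-dependency `a x₁ + b x₂ = 0` to the multiplicative relation
`exp(x₁ w)^a · exp(x₂ w)^b = 1` along the line (`‖x_i w‖ < ℓ⁻¹`). [folklore] -/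
theorem exp_zpow_mul_exp_zpow_eq_one {x₁ x₂ w : E} {a b : ℤ} (hrel : a • x₁ + b • x₂ = 0)
    (h₁ : ‖x₁ * w‖ < (ℓ : ℝ)⁻¹) (h₂ : ‖x₂ * w‖ < (ℓ : ℝ)⁻¹) :
    exp (x₁ * w) ^ a * exp (x₂ * w) ^ b = 1 := by
  rw [← PadicExp.exp_intCast_mul h₁, ← PadicExp.exp_intCast_mul h₂, ← PadicExp.exp_add (ℓ := ℓ)]
  · have : (a : E) * (x₁ * w) + (b : E) * (x₂ * w) = (a • x₁ + b • x₂) * w := by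
      simp only [zsmul_eq_mul]; ring
    rw [this, hrel, zero_mul, exp_zero]
  · rw [norm_mul]
    exact (mul_le_of_le_one_left (norm_nonneg _) (PadicExp.norm_intCast_le_one (ℓ := ℓ) _)).trans_lt h₁
  · rw [norm_mul]
    exact (mul_le_of_le_one_left (norm_nonneg _) (PadicExp.norm_intCast_le_one (ℓ := ℓ) _)).trans_lt h₂

end SixExp

/-! ### B1. Quadratic fields: the non-trivial automorphism, the two embeddings, norms -/

section Quad

variable {K : Type} [Field K] [NumberField K] [Algebra.IsQuadraticExtension ℚ K]

/-- A quadratic number field has a non-trivial involution `c` and `Gal(K/ℚ) = {1, c}`.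
[folklore] -/
theorem exists_aut : ∃ c : K ≃ₐ[ℚ] K, c ≠ 1 ∧ c * c = 1 ∧ ∀ σ : K ≃ₐ[ℚ] K, σ = 1 ∨ σ = c := by
  classical
  have hcard : Fintype.card (K ≃ₐ[ℚ] K) = 2 := by
    rw [← Nat.card_eq_fintype_card, IsGalois.card_aut_eq_finrank,
      Algebra.IsQuadraticExtension.finrank_eq_two]
  obtain ⟨c, hc⟩ := Fintype.exists_ne_of_one_lt_card (by omega : 1 < Fintype.card (K ≃ₐ[ℚ] K)) 1
  refine ⟨c, hc, ?_, fun σ => ?_⟩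
  · have := pow_card_eq_one (G := K ≃ₐ[ℚ] K) (x := c)
    rwa [hcard, pow_two] at this
  · by_contra hσ
    push Not at hσ
    have h3 : ({1, c, σ} : Finset (K ≃ₐ[ℚ] K)).card = 3 := by
      rw [Finset.card_insert_of_notMem, Finset.card_pair (Ne.symm hσ.2)]
      simp only [Finset.mem_insert, Finset.mem_singleton, not_or]
      exact ⟨Ne.symm hc, Ne.symm hσ.1⟩
    have := Finset.card_le_univ ({1, c, σ} : Finset (K ≃ₐ[ℚ] K))
    omega

variable {ℓ : ℕ} [Fact ℓ.Prime]

/-- The embeddings `K → ℚ̄_ℓ` of a quadratic field are `τ₁` and `τ₁ ∘ c ≠ τ₁`. [folklore] -/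
theorem univ_eq_pair [DecidableEq (K →+* PadicAlgCl ℓ)] {c : K ≃ₐ[ℚ] K} (hc : c ≠ 1)
    (τ₁ : K →+* PadicAlgCl ℓ) :
    τ₁.comp (c : K →+* K) ≠ τ₁ ∧
      (Finset.univ : Finset (K →+* PadicAlgCl ℓ)) = {τ₁, τ₁.comp (c : K →+* K)} := by
  have hne : τ₁.comp (c : K →+* K) ≠ τ₁ := by
    intro h
    apply hc
    ext x
    have := RingHom.congr_fun h x
    simp only [RingHom.coe_comp, Function.comp_apply, RingHom.coe_coe] at this
    exact τ₁.injective this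
  refine ⟨hne, ?_⟩
  symm
  apply Finset.eq_univ_of_card
  rw [Finset.card_pair (Ne.symm hne), Embeddings.card, Algebra.IsQuadraticExtension.finrank_eq_two]

omit [Algebra.IsQuadraticExtension ℚ K] [Fact ℓ.Prime] in
/-- `c (c k) = k`. [folklore] -/
theorem aut_aut {c : K ≃ₐ[ℚ] K} (hcc : c * c = 1) (k : K) : c (c k) = k := by
  rw [← AlgEquiv.mul_apply, hcc, AlgEquiv.one_apply]

omit [Fact ℓ.Prime] in
/-- The norm `k · c(k)` of a quadratic field element is rational. [folklore] -/
theorem exists_algebraMap_eq_mul_aut {c : K ≃ₐ[ℚ] K} (hcc : c * c = 1)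
    (hall : ∀ σ : K ≃ₐ[ℚ] K, σ = 1 ∨ σ = c) (k : K) :
    ∃ q : ℚ, algebraMap ℚ K q = k * c k := by
  have h := (IsGalois.mem_range_algebraMap_iff_fixed (F := ℚ) (k * c k)).mpr (fun f => by
    rcases hall f with rfl | rfl
    · rfl
    · rw [map_mul, aut_aut hcc, mul_comm])
  obtain ⟨q, hq⟩ := h
  exact ⟨q, hq⟩

omit [Algebra.IsQuadraticExtension ℚ K] [Fact ℓ.Prime] in
/-- **Congruences are transported by automorphisms**: `k ≡ 1 [ℓ^s] ⇒ σ k ≡ 1 [ℓ^s]` for a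
ring endomorphism `σ` of `K`. [folklore] -/
theorem cong_map_sub_one (σ : K →+* K) {s : ℕ} {k : K}
    (hk : ∀ v : HeightOneSpectrum (𝓞 K), (ℓ : 𝓞 K) ∈ v.asIdeal →
      v.valuation K (k - 1) ≤ v.valuation K ((ℓ : K) ^ s)) :
    ∀ v : HeightOneSpectrum (𝓞 K), (ℓ : 𝓞 K) ∈ v.asIdeal →
      v.valuation K (σ k - 1) ≤ v.valuation K ((ℓ : K) ^ s) := by
  intro w hw
  obtain ⟨𝔮, e, he, -, hval⟩ := exists_valuation_comp_eq_pow σ w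
  -- `𝔮` lies over `ℓ`
  have hwℓ : w.valuation K (ℓ : K) < 1 := Cong.valuation_ell_lt_one hw
  have h𝔮ℓ : (ℓ : 𝓞 K) ∈ 𝔮.asIdeal := by
    by_contra h
    have h1 : 𝔮.valuation K (ℓ : K) = 1 := by
      rw [show (ℓ : K) = algebraMap (𝓞 K) K (ℓ : 𝓞 K) by simp, valuation_eq_one_iff_notMem]
      exact h
    have h2 := hval (ℓ : K)
    rw [map_natCast, h1, one_pow] at h2
    exact absurd h2 hwℓ.ne
  rw [← map_one σ, ← map_sub, hval, show (ℓ : K) ^ s = σ ((ℓ : K) ^ s) by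
    rw [map_pow, map_natCast], hval]
  exact pow_le_pow_left' (hk 𝔮 h𝔮ℓ) e

omit [Algebra.IsQuadraticExtension ℚ K] [Fact ℓ.Prime] in
/-- `k ≡ 1, k' ≡ 1 [ℓ^s] ⇒ k k' ≡ 1 [ℓ^s]`. [folklore] -/
theorem cong_mul_sub_one {s : ℕ} {k k' : K}
    (hk : ∀ v : HeightOneSpectrum (𝓞 K), (ℓ : 𝓞 K) ∈ v.asIdeal →
      v.valuation K (k - 1) ≤ v.valuation K ((ℓ : K) ^ s))
    (hk' : ∀ v : HeightOneSpectrum (𝓞 K), (ℓ : 𝓞 K) ∈ v.asIdeal →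
      v.valuation K (k' - 1) ≤ v.valuation K ((ℓ : K) ^ s)) :
    ∀ v : HeightOneSpectrum (𝓞 K), (ℓ : 𝓞 K) ∈ v.asIdeal →
      v.valuation K (k * k' - 1) ≤ v.valuation K ((ℓ : K) ^ s) := by
  have := Cong.prod_sub_one (K := K) (ℓ := ℓ) (Finset.univ : Finset (Fin 2)) ![k, k']
    (fun i _ => by fin_cases i <;> assumption)
  simpa [Fin.prod_univ_two] using this

omit [Algebra.IsQuadraticExtension ℚ K] [Fact ℓ.Prime] in
/-- `k ≡ 1, k' ≡ 1 [ℓ^s]`, `s ≥ 1` ⇒ `k / k' ≡ 1 [ℓ^s]`. [folklore] -/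
theorem cong_div_sub_one {s : ℕ} (hs : 1 ≤ s) {k k' : K}
    (hk : ∀ v : HeightOneSpectrum (𝓞 K), (ℓ : 𝓞 K) ∈ v.asIdeal →
      v.valuation K (k - 1) ≤ v.valuation K ((ℓ : K) ^ s))
    (hk' : ∀ v : HeightOneSpectrum (𝓞 K), (ℓ : 𝓞 K) ∈ v.asIdeal →
      v.valuation K (k' - 1) ≤ v.valuation K ((ℓ : K) ^ s)) :
    ∀ v : HeightOneSpectrum (𝓞 K), (ℓ : 𝓞 K) ∈ v.asIdeal →
      v.valuation K (k / k' - 1) ≤ v.valuation K ((ℓ : K) ^ s) := by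
  intro v hv
  have hk'1 := Cong.valuation_eq_one_of_sub_one hs hk' v hv
  have hk'0 : k' ≠ 0 := by
    rintro rfl
    rw [Valuation.map_zero] at hk'1
    exact zero_ne_one hk'1
  have e : k / k' - 1 = ((k - 1) - (k' - 1)) * k'⁻¹ := by field_simp; ring
  have h := Cong.mul (Cong.sub hk hk') (Cong.zero_inv_of_sub_one hs hk') v hv
  rw [add_zero] at h
  rw [e]
  exact h

end Quad

end Quadratic

end Literature.NumberTheory.GaloisRepresentations

/-! ### B2. Test elements for the anti-invariant line -/

namespace Literature.NumberTheory.GaloisRepresentations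

namespace Quadratic

open scoped NumberField
open NumberField IsDedekindDomain IsDedekindDomain.HeightOneSpectrum Filter Finset
open Literature.NumberTheory.LFunctions.NumberField (HasDirichletDensity)

variable {K : Type} [Field K] [NumberField K]

/-- The comap of a place under a ring endomorphism of `𝓞 K` is non-zero. [folklore] -/
theorem comap_ne_bot (σ : 𝓞 K →+* 𝓞 K) (v : HeightOneSpectrum (𝓞 K)) :
    Ideal.comap σ v.asIdeal ≠ ⊥ := by
  intro h
  have hmem : ((Ideal.absNorm v.asIdeal : ℕ) : 𝓞 K) ∈ Ideal.comap σ v.asIdeal := by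
    rw [Ideal.mem_comap, map_natCast]
    exact Ideal.absNorm_mem v.asIdeal
  rw [h, Ideal.mem_bot, Nat.cast_eq_zero, Ideal.absNorm_eq_zero_iff] at hmem
  exact v.ne_bot hmem

/-- **A degree-one prime stable under an endomorphism `σ` divides `x - σ x`.**  If `N(𝔭) = p`
is prime, `p ∉ 𝔭²`, and `σ(𝔭) ⊆ 𝔭`, then every `x ∈ 𝓞_K` is `≡ a ∈ ℤ mod 𝔭`, so
`x - σ x ∈ 𝔭`. [folklore] -/
theorem sub_map_mem_of_stable (σ : 𝓞 K →+* 𝓞 K) (v : HeightOneSpectrum (𝓞 K)) {p : ℕ}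
    (hp : p.Prime) (hN : Ideal.absNorm v.asIdeal = p) (hp2 : (p : 𝓞 K) ∉ v.asIdeal ^ 2)
    (hstab : ∀ y, y ∈ v.asIdeal → σ y ∈ v.asIdeal) (x : 𝓞 K) : x - σ x ∈ v.asIdeal := by
  obtain ⟨a, ha⟩ := forall_exists_intCast_quotient_pow v hp hN hp2 1 (Ideal.Quotient.mk _ x)
  have h1 : x - a ∈ v.asIdeal := by
    have := (Ideal.Quotient.eq (I := v.asIdeal ^ 1)).mp ha.symm
    rwa [pow_one] at this
  have h2 : σ x - a ∈ v.asIdeal := by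
    have := hstab _ h1
    rwa [map_sub, map_intCast] at this
  have := v.asIdeal.sub_mem h1 h2
  rwa [sub_sub_sub_cancel_right] at this

omit [NumberField K] in
/-- `1 + C₀ y ∉ 𝔭` when `y ∈ 𝔭`. [folklore] -/
theorem one_add_mul_not_mem {𝔭 : Ideal (𝓞 K)} (h𝔭 : 𝔭 ≠ ⊤) {C y : 𝓞 K} (hy : y ∈ 𝔭) :
    1 + C * y ∉ 𝔭 := by
  intro h
  apply h𝔭
  rw [Ideal.eq_top_iff_one]
  have := 𝔭.sub_mem h (𝔭.mul_mem_left C hy)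
  rwa [add_sub_cancel_right] at this

/-- **Three test primes and elements for the anti-invariant line.**  Let `σ` be a ring
endomorphism of `𝓞 K` with `σ ∘ σ = id` moving some `x₀`, and `C₀ ≠ 0`.  There are places
`𝔭₁, 𝔭₂, 𝔭₃` and integers `x₁, x₂, x₃` such that `k_j = 1 + C₀ x_j` lies in `𝔭_j`, outside `𝔭_i`
for `i ≠ j`, and `σ(k_j)` lies outside every `𝔭_i` (degree-one primes not stable under `σ` and
prime to `C₀`, which have density one; the Chinese remainder theorem for the six primes
`𝔭_i, σ⁻¹𝔭_i`). [folklore] -/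
theorem exists_test_elements (σ : 𝓞 K →+* 𝓞 K) (hσσ : ∀ y, σ (σ y) = y) {x₀ : 𝓞 K}
    (hx₀ : σ x₀ ≠ x₀) {C₀ : ℕ} (hC₀ : C₀ ≠ 0) :
    ∃ (x : Fin 3 → 𝓞 K) (𝔭 : Fin 3 → HeightOneSpectrum (𝓞 K)),
      (∀ i j, σ (1 + C₀ * x j) ∉ (𝔭 i).asIdeal) ∧
      (∀ i j, i ≠ j → (1 + C₀ * x j) ∉ (𝔭 i).asIdeal) ∧
      (∀ j, (1 + C₀ * x j) ∈ (𝔭 j).asIdeal) := by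
  classical
  -- the conjugation on places (only its membership characterisation is used)
  obtain ⟨conj, hconj⟩ : ∃ conj : HeightOneSpectrum (𝓞 K) → HeightOneSpectrum (𝓞 K),
      ∀ v y, y ∈ (conj v).asIdeal ↔ σ y ∈ v.asIdeal :=
    ⟨fun v => ⟨Ideal.comap σ v.asIdeal, Ideal.comap_isPrime σ v.asIdeal, comap_ne_bot σ v⟩,
      fun v y => Ideal.mem_comap⟩
  have hconj2 : ∀ v, conj (conj v) = v := by
    intro v; ext y; rw [hconj, hconj, hσσ]
  have hconj_inj : ∀ v w, conj v = conj w → v = w := fun v w h => by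
    rw [← hconj2 v, h, hconj2]
  -- the good places
  have hfinmem : ∀ {z : 𝓞 K}, z ≠ 0 → {v : HeightOneSpectrum (𝓞 K) | z ∈ v.asIdeal}.Finite := by
    intro z hz
    have hne : (Ideal.span {z} : Ideal (𝓞 K)) ≠ ⊥ := by rwa [Ne, Ideal.span_singleton_eq_bot]
    refine (Ideal.finite_factors hne).subset fun v hv => ?_
    simp only [Set.mem_setOf_eq] at hv ⊢
    exact (Ideal.dvd_span_singleton).mpr hv
  have hz : x₀ - σ x₀ ≠ 0 := sub_ne_zero.mpr (Ne.symm hx₀)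
  have hC : ((C₀ : ℕ) : 𝓞 K) ≠ 0 := by exact_mod_cast hC₀
  have h𝓛 : HasDirichletDensity K {v : HeightOneSpectrum (𝓞 K) |
      ((Ideal.absNorm v.asIdeal).Prime → ((Ideal.absNorm v.asIdeal : ℕ) : 𝓞 K) ∉ v.asIdeal ^ 2) ∧
      (((C₀ : ℕ) : 𝓞 K) ∉ v.asIdeal ∧ (x₀ - σ x₀) ∉ v.asIdeal)} 1 := by
    refine hasDirichletDensity_one_of_eventually
      ((eventually_natCast_absNorm_not_mem_sq (K := K)).and ((Filter.eventually_cofinite.mpr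
        ((hfinmem hC).subset fun v hv => ?_)).and (Filter.eventually_cofinite.mpr
        ((hfinmem hz).subset fun v hv => ?_))))
    · simpa using hv
    · simpa using hv
  have hT := hasDirichletDensity_one_setOf_prime_absNorm K
  have hgood : ∀ v : HeightOneSpectrum (𝓞 K),
      v ∈ {v : HeightOneSpectrum (𝓞 K) |
        ((Ideal.absNorm v.asIdeal).Prime → ((Ideal.absNorm v.asIdeal : ℕ) : 𝓞 K) ∉ v.asIdeal ^ 2) ∧
        (((C₀ : ℕ) : 𝓞 K) ∉ v.asIdeal ∧ (x₀ - σ x₀) ∉ v.asIdeal)} →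
      v ∈ {v : HeightOneSpectrum (𝓞 K) | (Ideal.absNorm v.asIdeal).Prime} →
      conj v ≠ v ∧ ((C₀ : ℕ) : 𝓞 K) ∉ v.asIdeal := by
    intro v hv hvT
    simp only [Set.mem_setOf_eq] at hv hvT
    refine ⟨fun hstab => hv.2.2 ?_, hv.2.1⟩
    refine sub_map_mem_of_stable σ v hvT rfl (hv.1 hvT) (fun y hy => ?_) x₀
    rw [← hconj, hstab]; exact hy
  -- three good places
  obtain ⟨𝔭₁, h𝔭₁𝓛, h𝔭₁T, -⟩ :=
    h𝓛.exists_mem_inter_not_mem_of_one_of_pos hT one_pos Set.finite_empty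
  obtain ⟨𝔭₂, h𝔭₂𝓛, h𝔭₂T, h𝔭₂F⟩ := h𝓛.exists_mem_inter_not_mem_of_one_of_pos hT one_pos
    (Set.toFinite ({𝔭₁, conj 𝔭₁} : Set (HeightOneSpectrum (𝓞 K))))
  obtain ⟨𝔭₃, h𝔭₃𝓛, h𝔭₃T, h𝔭₃F⟩ := h𝓛.exists_mem_inter_not_mem_of_one_of_pos hT one_pos
    (Set.toFinite ({𝔭₁, conj 𝔭₁, 𝔭₂, conj 𝔭₂} : Set (HeightOneSpectrum (𝓞 K))))
  obtain ⟨h1, hC1⟩ := hgood 𝔭₁ h𝔭₁𝓛 h𝔭₁T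
  obtain ⟨h2, hC2⟩ := hgood 𝔭₂ h𝔭₂𝓛 h𝔭₂T
  obtain ⟨h3, hC3⟩ := hgood 𝔭₃ h𝔭₃𝓛 h𝔭₃T
  simp only [Set.mem_insert_iff, Set.mem_singleton_iff, not_or] at h𝔭₂F h𝔭₃F
  obtain ⟨e21, e21'⟩ := h𝔭₂F
  obtain ⟨e31, e31', e32, e32'⟩ := h𝔭₃F
  -- the family
  obtain ⟨𝔭, h𝔭0, h𝔭1, h𝔭2⟩ : ∃ 𝔭 : Fin 3 → HeightOneSpectrum (𝓞 K),
      𝔭 0 = 𝔭₁ ∧ 𝔭 1 = 𝔭₂ ∧ 𝔭 2 = 𝔭₃ := ⟨![𝔭₁, 𝔭₂, 𝔭₃], rfl, rfl, rfl⟩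
  have h𝔭C : ∀ j, ((C₀ : ℕ) : 𝓞 K) ∉ (𝔭 j).asIdeal := by
    intro j; fin_cases j
    · simpa [h𝔭0] using hC1
    · simpa [h𝔭1] using hC2
    · simpa [h𝔭2] using hC3
  have hF1 : ∀ i j : Fin 3, 𝔭 i = 𝔭 j → i = j := by
    intro i j h
    fin_cases i <;> fin_cases j <;> simp only [h𝔭0, h𝔭1, h𝔭2, Fin.zero_eta, Fin.mk_one,
      Fin.isValue, Fin.reduceFinMk] at h ⊢
    all_goals first
      | rfl
      | exact absurd h.symm e21
      | exact absurd h e21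
      | exact absurd h.symm e31
      | exact absurd h e31
      | exact absurd h.symm e32
      | exact absurd h e32
  have hflip : ∀ v w : HeightOneSpectrum (𝓞 K), v ≠ conj w → conj v ≠ w := by
    intro v w h heq
    apply h
    rw [← heq, hconj2]
  have hF2 : ∀ i j : Fin 3, conj (𝔭 i) ≠ 𝔭 j := by
    intro i j
    fin_cases i <;> fin_cases j <;> simp only [h𝔭0, h𝔭1, h𝔭2, Fin.zero_eta, Fin.mk_one,
      Fin.isValue, Fin.reduceFinMk]
    · exact h1
    · exact Ne.symm e21'
    · exact Ne.symm e31'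
    · exact hflip _ _ e21'
    · exact h2
    · exact Ne.symm e32'
    · exact hflip _ _ e31'
    · exact hflip _ _ e32'
    · exact h3
  -- residues `t_j` with `1 + C₀ t_j ∈ 𝔭_j`
  have ht : ∀ j, ∃ t : 𝓞 K, 1 + (C₀ : 𝓞 K) * t ∈ (𝔭 j).asIdeal := by
    intro j
    haveI := (𝔭 j).isMaximal
    letI := Ideal.Quotient.field (𝔭 j).asIdeal
    have hCj : (Ideal.Quotient.mk (𝔭 j).asIdeal ((C₀ : ℕ) : 𝓞 K)) ≠ 0 := by
      rw [Ne, Ideal.Quotient.eq_zero_iff_mem]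
      exact h𝔭C j
    obtain ⟨t, ht⟩ := Ideal.Quotient.mk_surjective
      (-(Ideal.Quotient.mk (𝔭 j).asIdeal ((C₀ : ℕ) : 𝓞 K))⁻¹)
    refine ⟨t, ?_⟩
    rw [← Ideal.Quotient.eq_zero_iff_mem, map_add, map_one, map_mul, ht, map_natCast,
      mul_neg, mul_inv_cancel₀ (by exact_mod_cast hCj), add_neg_cancel]
  choose t ht using ht
  -- the Chinese remainder theorem on the six primes `𝔭_i`, `conj 𝔭_i`
  set P : Fin 3 × Bool → Ideal (𝓞 K) := fun ib =>
    if ib.2 then (conj (𝔭 ib.1)).asIdeal else (𝔭 ib.1).asIdeal with hPdef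
  have hPprime : ∀ ib ∈ (Finset.univ : Finset (Fin 3 × Bool)), Prime (P ib) := by
    rintro ⟨i, b⟩ -
    cases b
    · exact Ideal.prime_of_isPrime (𝔭 i).ne_bot (𝔭 i).isPrime
    · exact Ideal.prime_of_isPrime (conj (𝔭 i)).ne_bot (conj (𝔭 i)).isPrime
  have hPne : ∀ ib ∈ (Finset.univ : Finset (Fin 3 × Bool)), ∀ ib' ∈ (Finset.univ :
      Finset (Fin 3 × Bool)), ib ≠ ib' → P ib ≠ P ib' := by
    rintro ⟨i, b⟩ - ⟨i', b'⟩ - hne heq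
    apply hne
    have hext : ∀ v w : HeightOneSpectrum (𝓞 K), v.asIdeal = w.asIdeal → v = w :=
      fun v w h => HeightOneSpectrum.ext h
    cases b <;> cases b' <;> simp only [hPdef, Bool.false_eq_true, ↓reduceIte] at heq
    · rw [hF1 i i' (hext _ _ heq)]
    · exact absurd (hext _ _ heq).symm (hF2 i' i)
    · exact absurd (hext _ _ heq) (hF2 i i')
    · rw [hF1 i i' (hconj_inj _ _ (hext _ _ heq))]
  have hx : ∀ j, ∃ y : 𝓞 K, y - t j ∈ (𝔭 j).asIdeal ∧ (∀ i, i ≠ j → y ∈ (𝔭 i).asIdeal) ∧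
      ∀ i, y ∈ (conj (𝔭 i)).asIdeal := by
    intro j
    obtain ⟨y, hy⟩ := IsDedekindDomain.exists_forall_sub_mem_ideal (s := Finset.univ) P
      (fun _ => 1) hPprime hPne (fun ib => if ib.1 = (j, false) then t j else 0)
    refine ⟨y, ?_, fun i hij => ?_, fun i => ?_⟩
    · have := hy (j, false) (Finset.mem_univ _)
      simpa [hPdef] using this
    · have := hy (i, false) (Finset.mem_univ _)
      have hne : ((i, false) : Fin 3 × Bool) ≠ (j, false) := by simpa using hij
      simpa [hPdef, hne] using this
    · have := hy (i, true) (Finset.mem_univ _)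
      simpa [hPdef] using this
  choose x hxt hxi hxc using hx
  refine ⟨x, 𝔭, fun i j => ?_, fun i j hij => ?_, fun j => ?_⟩
  · -- `σ(1 + C₀ x_j) ∉ 𝔭_i` since `x_j ∈ conj 𝔭_i`
    rw [← hconj]
    exact one_add_mul_not_mem (conj (𝔭 i)).isPrime.ne_top (hxc j i)
  · exact one_add_mul_not_mem (𝔭 i).isPrime.ne_top (hxi j i hij)
  · have e : (1 : 𝓞 K) + C₀ * x j = (1 + C₀ * t j) + C₀ * (x j - t j) := by ring
    rw [e]
    exact (𝔭 j).asIdeal.add_mem (ht j) ((𝔭 j).asIdeal.mul_mem_left _ (hxt j))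

end Quadratic

end Literature.NumberTheory.GaloisRepresentations

/-! ### B3. The rational line: `F(q)^{B₁} = q^{A₁}` for rational `q ≡ 1 [ℓ^s]` -/

namespace Literature.NumberTheory.GaloisRepresentations

namespace Quadratic

open scoped NumberField
open NumberField IsDedekindDomain IsDedekindDomain.HeightOneSpectrum Filter Topology Finset NormedSpace
open Literature.NumberTheory.Transcendental

section UltraLemmas

variable {ℓ : ℕ} [Fact ℓ.Prime] {E : Type} [NontriviallyNormedField E] [NormedAlgebra ℚ_[ℓ] E]
  [IsUltrametricDist E] [CompleteSpace E]

omit [Fact ℓ.Prime] [NormedAlgebra ℚ_[ℓ] E] [CompleteSpace E] in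
/-- `‖1 - ∏ yᵢ‖ ≤ r` when all `‖1 - yᵢ‖ ≤ r < 1`. [folklore] -/
theorem norm_one_sub_prod_le {ι : Type*} (s : Finset ι) (y : ι → E) {r : ℝ} (hr0 : 0 ≤ r)
    (hr1 : r < 1) (hy : ∀ i ∈ s, ‖1 - y i‖ ≤ r) : ‖1 - ∏ i ∈ s, y i‖ ≤ r := by
  classical
  induction s using Finset.induction_on with
  | empty => simpa using hr0
  | insert a s ha ih =>
    have hya := hy a (Finset.mem_insert_self a s)
    have ih' := ih fun i hi => hy i (Finset.mem_insert_of_mem hi)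
    rw [Finset.prod_insert ha,
      show (1 : E) - y a * ∏ i ∈ s, y i = (1 - y a) + y a * (1 - ∏ i ∈ s, y i) by ring]
    refine (IsUltrametricDist.norm_add_le_max _ _).trans (max_le hya ?_)
    rw [norm_mul, IwasawaLog.norm_eq_one_of_norm_one_sub_lt (hya.trans_lt hr1), one_mul]
    exact ih'

omit [Fact ℓ.Prime] [NormedAlgebra ℚ_[ℓ] E] [CompleteSpace E] in
/-- `‖1 - ∏ yᵢ^{eᵢ}‖ ≤ r` when all `‖1 - yᵢ‖ ≤ r < 1`. [folklore] -/
theorem norm_one_sub_prod_pow_le {ι : Type*} (s : Finset ι) (y : ι → E) (e : ι → ℕ) {r : ℝ}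
    (hr0 : 0 ≤ r) (hr1 : r < 1) (hy : ∀ i ∈ s, ‖1 - y i‖ ≤ r) :
    ‖1 - ∏ i ∈ s, y i ^ e i‖ ≤ r := by
  refine norm_one_sub_prod_le s _ hr0 hr1 fun i hi => ?_
  have := norm_one_sub_prod_le (Finset.range (e i)) (fun _ => y i) hr0 hr1 fun _ _ => hy i hi
  simpa using this

end UltraLemmas

variable {K : Type} [Field K] [NumberField K] {ℓ : ℕ} [Fact ℓ.Prime]
variable {E : Type} [NontriviallyNormedField E] [NormedAlgebra ℚ_[ℓ] E] [IsUltrametricDist E]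
  [CompleteSpace E]

omit [Fact ℓ.Prime] in
/-- An integer `≡ 1 mod NS` is a unit at every place whose norm divides `NS`. [folklore] -/
theorem valuation_one_add_mul_eq_one {NS : ℕ} {w : HeightOneSpectrum (𝓞 K)}
    (hw : Ideal.absNorm w.asIdeal ∣ NS) (z : 𝓞 K) :
    w.valuation K (((1 + (NS : 𝓞 K) * z : 𝓞 K)) : K) = 1 := by
  rw [show (((1 + (NS : 𝓞 K) * z : 𝓞 K)) : K) = algebraMap (𝓞 K) K (1 + (NS : 𝓞 K) * z) from rfl,
    valuation_eq_one_iff_notMem, show (1 : 𝓞 K) + (NS : 𝓞 K) * z = 1 + z * NS by ring]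
  refine one_add_mul_not_mem w.isPrime.ne_top ?_
  obtain ⟨d, hd⟩ := hw
  rw [hd, Nat.cast_mul]
  exact w.asIdeal.mul_mem_right _ (Ideal.absNorm_mem w.asIdeal)

/-- **The rational line.**  Suppose `F : Kˣ → E` is multiplicative with algebraic values at
the units congruent to `1` modulo the norms of `S`, and on the rationals `q ≡ 1 [ℓ^s]` one has
`q = exp(M · L(q))`, `F(q) = exp(Λ · L(q))` (`L` the logarithmic series).  Then `F(q)^B = q^A` for
some `B ≥ 1`, `A ∈ ℤ` and all such `q` (six exponentials at three primes `p ≡ 1 mod ℓ^{s'} N_S`).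
[cite: SerreAbelianLadic1968, Ch. III §3] -/
theorem rational_line (S : Finset (HeightOneSpectrum (𝓞 K))) {NS : ℕ} (hNS0 : NS ≠ 0)
    (hNS : ∀ w ∈ S, Ideal.absNorm w.asIdeal ∣ NS) (F : Kˣ →* E)
    (hFalg : ∀ u : Kˣ, (∀ w ∈ S, (ℓ : 𝓞 K) ∉ w.asIdeal → w.valuation K (u : K) = 1) →
      IsAlgebraic ℤ (F u))
    {s : ℕ} (hs : 1 ≤ s) (Λ Mp : E)
    (hline : ∀ (q : ℚ) (hq : algebraMap ℚ K q ≠ 0),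
      (∀ v : HeightOneSpectrum (𝓞 K), (ℓ : 𝓞 K) ∈ v.asIdeal →
        v.valuation K (algebraMap ℚ K q - 1) ≤ v.valuation K ((ℓ : K) ^ s)) →
      ‖Mp * ∑' m : ℕ, -((1 - (q : E)) ^ (m + 1)) / (m + 1 : E)‖ < (ℓ : ℝ)⁻¹ ∧
      ‖Λ * ∑' m : ℕ, -((1 - (q : E)) ^ (m + 1)) / (m + 1 : E)‖ < (ℓ : ℝ)⁻¹ ∧
      (q : E) = exp (Mp * ∑' m : ℕ, -((1 - (q : E)) ^ (m + 1)) / (m + 1 : E)) ∧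
      F (Units.mk0 _ hq) = exp (Λ * ∑' m : ℕ, -((1 - (q : E)) ^ (m + 1)) / (m + 1 : E))) :
    ∃ B : ℕ, 0 < B ∧ ∃ A : ℤ, ∀ (q : ℚ) (hq : algebraMap ℚ K q ≠ 0),
      (∀ v : HeightOneSpectrum (𝓞 K), (ℓ : 𝓞 K) ∈ v.asIdeal →
        v.valuation K (algebraMap ℚ K q - 1) ≤ v.valuation K ((ℓ : K) ^ s)) →
      F (Units.mk0 _ hq) ^ B = ((q : E)) ^ A := by
  classical
  haveI : CharZero E := charZero_of_injective_algebraMap (algebraMap ℚ_[ℓ] E).injective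
  have hp : ℓ.Prime := Fact.out
  set q₀ : ℝ := (ℓ : ℝ)⁻¹ with hq₀def
  have hq0 : 0 < q₀ := inv_pos.mpr (by exact_mod_cast hp.pos)
  have hq1 : q₀ < 1 := inv_lt_one_of_one_lt₀ (by exact_mod_cast hp.one_lt)
  have hq2 : q₀ ≤ 1 / 2 := by
    rw [hq₀def, one_div]; exact inv_anti₀ two_pos (by exact_mod_cast hp.two_le)
  -- congruence of a rational `1 + ℓ^j NS m`
  have hcongr : ∀ (j m : ℕ), ∀ v : HeightOneSpectrum (𝓞 K), (ℓ : 𝓞 K) ∈ v.asIdeal →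
      v.valuation K (algebraMap ℚ K ((1 + ℓ ^ j * (NS * m) : ℕ) : ℚ) - 1) ≤
        v.valuation K ((ℓ : K) ^ j) := by
    intro j m
    have e : algebraMap ℚ K ((1 + ℓ ^ j * (NS * m) : ℕ) : ℚ) - 1 = (ℓ : K) ^ j * ((NS * m : ℕ) : K) := by
      rw [map_natCast]; push_cast; ring
    rw [e]
    have := Cong.mul (Cong.pow_self (K := K) (ℓ := ℓ) j) (Cong.zero_natCast (K := K) (ℓ := ℓ) (NS * m))
    rwa [add_zero] at this
  by_cases hli : ¬ LinearIndependent ℤ ![Mp, Λ]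
  · -- ### dependent: the relation on the whole line
    rw [LinearIndependent.pair_iff] at hli
    push Not at hli
    obtain ⟨a, b, hrel, hab⟩ := hli
    have hline' : ∀ (q : ℚ) (hq : algebraMap ℚ K q ≠ 0),
        (∀ v : HeightOneSpectrum (𝓞 K), (ℓ : 𝓞 K) ∈ v.asIdeal →
          v.valuation K (algebraMap ℚ K q - 1) ≤ v.valuation K ((ℓ : K) ^ s)) →
        ((q : E)) ^ a * F (Units.mk0 _ hq) ^ b = 1 := by
      intro q hq hcq
      obtain ⟨h1, h2, h3, h4⟩ := hline q hq hcq
      conv_lhs => rw [h3, h4]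
      exact exp_zpow_mul_exp_zpow_eq_one (ℓ := ℓ) hrel h1 h2
    -- `b ≠ 0`: test at `q = 1 + ℓ^s`
    have hb : b ≠ 0 := by
      intro hb0
      have ha0 : a ≠ 0 := fun h => hab h hb0
      have hqK : algebraMap ℚ K ((1 + ℓ ^ s * (NS * 1) : ℕ) : ℚ) ≠ 0 := by
        rw [map_natCast, Nat.cast_ne_zero]; omega
      have h1 := hline' _ hqK (hcongr s 1)
      rw [hb0, zpow_zero, mul_one, mul_one] at h1
      have h3 : ((1 + ℓ ^ s * NS : ℕ) : ℚ) ^ a = 1 := by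
        have : ((((1 + ℓ ^ s * NS : ℕ) : ℚ) ^ a : ℚ) : E) = ((1 : ℚ) : E) := by
          push_cast at h1 ⊢; exact h1
        exact_mod_cast this
      have hbase : (1 : ℚ) < ((1 + ℓ ^ s * NS : ℕ) : ℚ) := by
        have h4 : (0 : ℚ) < (ℓ : ℚ) ^ s := pow_pos (by exact_mod_cast hp.pos) s
        have h5 : (1 : ℚ) ≤ NS := by exact_mod_cast Nat.one_le_iff_ne_zero.mpr hNS0
        push_cast; nlinarith
      rcases lt_or_gt_of_ne ha0 with hneg | hpos
      · have := one_lt_zpow₀ hbase (neg_pos.mpr hneg)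
        rw [zpow_neg, h3, inv_one] at this
        exact lt_irrefl _ this
      · have := one_lt_zpow₀ hbase hpos
        rw [h3] at this
        exact lt_irrefl _ this
    -- normalise the sign of `b`
    rcases lt_or_gt_of_ne hb with hneg | hpos
    · refine ⟨(-b).toNat, by omega, a, fun q hq hcq => ?_⟩
      have h2 : F (Units.mk0 _ hq) ^ b = (((q : E)) ^ a)⁻¹ :=
        eq_inv_of_mul_eq_one_right (hline' q hq hcq)
      have e : (((-b).toNat : ℕ) : ℤ) = -b := Int.toNat_of_nonneg (by omega)
      rw [← zpow_natCast, e, zpow_neg, h2, inv_inv]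
    · refine ⟨b.toNat, by omega, -a, fun q hq hcq => ?_⟩
      have h2 : F (Units.mk0 _ hq) ^ b = (((q : E)) ^ a)⁻¹ :=
        eq_inv_of_mul_eq_one_right (hline' q hq hcq)
      have e : ((b.toNat : ℕ) : ℤ) = b := Int.toNat_of_nonneg hpos.le
      rw [← zpow_natCast, e, h2, zpow_neg]
  · -- ### independent: contradiction with the six exponentials theorem
    exfalso
    push Not at hli
    refine not_linearIndependent_of_exp_isAlgebraic (ℓ := ℓ) ![Mp, Λ] (fun t => ?_) hli
    -- three primes `p ≡ 1 mod ℓ^{s'} NS`, `s' = s + t + 1`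
    set s' : ℕ := s + t + 1 with hs'
    have hk₀ : ℓ ^ s' * NS ≠ 0 := mul_ne_zero (pow_ne_zero _ hp.ne_zero) hNS0
    obtain ⟨p₁, hp₁, -, hp₁m⟩ := Nat.exists_prime_gt_modEq_one 0 hk₀
    obtain ⟨p₂, hp₂, hp₂1, hp₂m⟩ := Nat.exists_prime_gt_modEq_one p₁ hk₀
    obtain ⟨p₃, hp₃, hp₃2, hp₃m⟩ := Nat.exists_prime_gt_modEq_one p₂ hk₀
    obtain ⟨pr, hpr0, hpr1, hpr2⟩ : ∃ pr : Fin 3 → ℕ, pr 0 = p₁ ∧ pr 1 = p₂ ∧ pr 2 = p₃ :=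
      ⟨![p₁, p₂, p₃], rfl, rfl, rfl⟩
    have hpr : ∀ j, (pr j).Prime ∧ pr j ≡ 1 [MOD ℓ ^ s' * NS] := by
      intro j; fin_cases j
      · simpa [hpr0] using And.intro hp₁ hp₁m
      · simpa [hpr1] using And.intro hp₂ hp₂m
      · simpa [hpr2] using And.intro hp₃ hp₃m
    have hprinj : Function.Injective pr := by
      intro i j hij
      fin_cases i <;> fin_cases j <;>
        simp only [hpr0, hpr1, hpr2, Fin.zero_eta, Fin.mk_one, Fin.isValue, Fin.reduceFinMk]
          at hij ⊢ <;> omega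
    -- `pⱼ = 1 + ℓ^{s'} NS mⱼ`
    have hform : ∀ j, ∃ m : ℕ, pr j = 1 + ℓ ^ s' * (NS * m) := by
      intro j
      have h1 : 1 ≤ pr j := (hpr j).1.one_lt.le
      obtain ⟨m, hm⟩ := (Nat.modEq_iff_dvd' h1).mp (hpr j).2.symm
      exact ⟨m, by rw [mul_assoc] at hm; omega⟩
    choose mj hmj using hform
    -- the elements of `K` and the data
    have hqK : ∀ j, algebraMap ℚ K ((pr j : ℕ) : ℚ) ≠ 0 := by
      intro j; rw [map_natCast]; exact_mod_cast (hpr j).1.ne_zero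
    have hcq : ∀ j, ∀ v : HeightOneSpectrum (𝓞 K), (ℓ : 𝓞 K) ∈ v.asIdeal →
        v.valuation K (algebraMap ℚ K ((pr j : ℕ) : ℚ) - 1) ≤ v.valuation K ((ℓ : K) ^ s) := by
      intro j
      have := hcongr s' (mj j)
      rw [← hmj j] at this
      exact Cong.mono this (by omega)
    -- norms: `‖1 - pⱼ‖ ≤ q₀^{s'}`
    have hnorm1 : ∀ j, ‖1 - ((pr j : ℕ) : E)‖ ≤ q₀ ^ s' := by
      intro j
      rw [hmj j]; push_cast
      rw [show (1 : E) - (1 + (ℓ : E) ^ s' * ((NS : E) * (mj j : E))) =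
        -((ℓ : E) ^ s' * ((NS * mj j : ℕ) : E)) by push_cast; ring, norm_neg, norm_mul,
        Expansion.norm_ell_pow]
      exact mul_le_of_le_one_right (pow_nonneg hq0.le _) (PadicExp.norm_natCast_le_one (ℓ := ℓ) _)
    have hs'2 : 2 ≤ s' := by omega
    have hqs'4 : q₀ ^ s' ≤ 1 / 4 := by
      calc q₀ ^ s' ≤ q₀ ^ 2 := pow_le_pow_of_le_one hq0.le hq1.le hs'2
        _ ≤ (1 / 2) ^ 2 := pow_le_pow_left₀ hq0.le hq2 2
        _ = 1 / 4 := by norm_num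
    have hqs'1 : q₀ ^ s' < 1 := pow_lt_one₀ hq0.le hq1 (by omega)
    set y : Fin 3 → E := fun j => ∑' m : ℕ, -((1 - ((pr j : ℕ) : E)) ^ (m + 1)) / (m + 1 : E)
      with hydef
    have hycast : ∀ j, (∑' m : ℕ, -((1 - (((pr j : ℕ) : ℚ) : E)) ^ (m + 1)) / (m + 1 : E)) = y j := by
      intro j; simp [hydef]
    refine ⟨y, ?_, fun j => ?_, fun i j => ?_⟩
    · -- independence of `y`
      rw [Fintype.linearIndependent_iff]
      intro k hk j0
      set kp : Fin 3 → ℕ := fun j => (k j).toNat with hkp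
      set kn : Fin 3 → ℕ := fun j => (-k j).toNat with hkn
      have hk_eq : ∀ j, (k j : ℤ) = kp j - kn j := fun j => by simp only [hkp, hkn]; omega
      have hprin : ∀ j, ‖1 - ((pr j : ℕ) : E)‖ < 1 := fun j => (hnorm1 j).trans_lt hqs'1
      have hLA := LogE.logSeries_prod_pow (ℓ := ℓ) Finset.univ (fun j => ((pr j : ℕ) : E)) kp
        (fun j _ => hprin j)
      have hLB := LogE.logSeries_prod_pow (ℓ := ℓ) Finset.univ (fun j => ((pr j : ℕ) : E)) kn
        (fun j _ => hprin j)
      have hsum : ∑ j, ((kp j : E)) * y j = ∑ j, ((kn j : E)) * y j := by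
        rw [← sub_eq_zero, ← Finset.sum_sub_distrib, ← hk]
        refine Finset.sum_congr rfl fun j _ => ?_
        rw [zsmul_eq_mul, hk_eq]; push_cast; ring
      have hLAB : (∑' m : ℕ, -((1 - ∏ j, ((pr j : ℕ) : E) ^ kp j) ^ (m + 1)) / (m + 1 : E)) =
          ∑' m : ℕ, -((1 - ∏ j, ((pr j : ℕ) : E) ^ kn j) ^ (m + 1)) / (m + 1 : E) := by
        rw [hLA, hLB]; exact hsum
      have hAB : ∏ j, ((pr j : ℕ) : E) ^ kp j = ∏ j, ((pr j : ℕ) : E) ^ kn j :=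
        LogE.eq_of_logSeries_eq (ℓ := ℓ)
          ((norm_one_sub_prod_pow_le _ _ _ (pow_nonneg hq0.le _) hqs'1 fun j _ => hnorm1 j).trans hqs'4)
          ((norm_one_sub_prod_pow_le _ _ _ (pow_nonneg hq0.le _) hqs'1 fun j _ => hnorm1 j).trans hqs'4)
          hLAB
      have hQ : (∏ j, ((pr j : ℚ)) ^ kp j : ℚ) = ∏ j, ((pr j : ℚ)) ^ kn j := by
        have h1 : ((∏ j, ((pr j : ℚ)) ^ kp j : ℚ) : E) = ((∏ j, ((pr j : ℚ)) ^ kn j : ℚ) : E) := by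
          push_cast; exact hAB
        exact_mod_cast h1
      have hzpow : ∏ j, ((pr j : ℚ)) ^ (k j) = 1 := by
        have hne : ∀ j, ((pr j : ℚ)) ≠ 0 := fun j => Nat.cast_ne_zero.mpr (hpr j).1.ne_zero
        have hB0 : (∏ j, ((pr j : ℚ)) ^ kn j : ℚ) ≠ 0 :=
          Finset.prod_ne_zero_iff.mpr fun j _ => pow_ne_zero _ (hne j)
        have : ∏ j, ((pr j : ℚ)) ^ (k j) = (∏ j, ((pr j : ℚ)) ^ kp j) / ∏ j, ((pr j : ℚ)) ^ kn j := by
          rw [eq_div_iff hB0, ← Finset.prod_mul_distrib]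
          refine Finset.prod_congr rfl fun j _ => ?_
          rw [← zpow_natCast, ← zpow_natCast, ← zpow_add₀ (hne j), hk_eq]
          ring_nf
        rw [this, hQ, div_self hB0]
      have hk0 := eq_zero_of_prod_prime_zpow_eq_one (fun j => (hpr j).1) hprinj hzpow
      exact congrFun hk0 j0
    · -- smallness
      rw [hydef]
      change ‖∑' m : ℕ, -((1 - ((pr j : ℕ) : E)) ^ (m + 1)) / (m + 1 : E)‖ ≤ q₀ ^ (t + 1)
      rw [LogE.norm_logSeries_eq (ℓ := ℓ) ((hnorm1 j).trans hqs'4)]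
      exact (hnorm1 j).trans (pow_le_pow_of_le_one hq0.le hq1.le (by omega))
    · -- algebraicity of the six values
      obtain ⟨h1, h2, h3, h4⟩ := hline _ (hqK j) (hcq j)
      rw [hycast] at h3 h4
      fin_cases i
      · -- `exp (Mp yⱼ) = pⱼ`
        change IsAlgebraic ℤ (exp (Mp * y j))
        rw [← h3]
        have : IsAlgebraic ℤ ((pr j : ℕ) : E) := by
          have := isAlgebraic_algebraMap (R := ℤ) (A := E) ((pr j : ℕ) : ℤ)
          simpa using this
        simpa using this
      · -- `exp (Λ yⱼ) = F(pⱼ)`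
        change IsAlgebraic ℤ (exp (Λ * y j))
        rw [← h4]
        refine hFalg _ fun w hw _ => ?_
        rw [Units.val_mk0, map_natCast]
        have e : ((pr j : ℕ) : K) = (((1 + (NS : 𝓞 K) * ((ℓ ^ s' * mj j : ℕ) : 𝓞 K) : 𝓞 K)) : K) := by
          rw [hmj j]; push_cast; ring
        rw [e]
        exact valuation_one_add_mul_eq_one (hNS w hw) _

end Quadratic

end Literature.NumberTheory.GaloisRepresentations

/-! ### B4. The anti-invariant line: `F(k/ck)^{B₂} = τ₁(k/ck)^{A₂}` for `k ≡ 1 [ℓ^s]` -/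

namespace Literature.NumberTheory.GaloisRepresentations

namespace Quadratic

open scoped NumberField
open NumberField IsDedekindDomain IsDedekindDomain.HeightOneSpectrum Filter Topology Finset NormedSpace
open Literature.NumberTheory.Transcendental

variable {K : Type} [Field K] [NumberField K] {ℓ : ℕ} [Fact ℓ.Prime]
variable {E : Type} [NontriviallyNormedField E] [NormedAlgebra ℚ_[ℓ] E] [IsUltrametricDist E]
  [CompleteSpace E]

omit [Fact ℓ.Prime] in
/-- In a linearly ordered value group, `x^m = x^n` with `0 < x < 1` forces `m = n`. [folklore] -/
theorem pow_injective_of_lt_one {x : WithZero (Multiplicative ℤ)} (hx0 : x ≠ 0) (hx1 : x < 1)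
    {m n : ℕ} (h : x ^ m = x ^ n) : m = n := by
  rcases lt_trichotomy m n with hmn | rfl | hnm
  · exact absurd h (ne_of_gt (pow_lt_pow_right_of_lt_one₀ (zero_lt_iff.mpr hx0) hx1 hmn))
  · rfl
  · exact absurd h (ne_of_lt (pow_lt_pow_right_of_lt_one₀ (zero_lt_iff.mpr hx0) hx1 hnm))

/-- **The anti-invariant line.**  Let `c` be an involution of `K` (restricting to `σ` on `𝓞_K`,
moving some `x₀`), `τ₁ : K → ℚ̄_ℓ`, `F : Kˣ → E` multiplicative with algebraic values at the units
congruent to `1` modulo the norms of `S`, and suppose that for `k ≡ 1 [ℓ^s]` the anti-invariant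
element `u = k / c k` satisfies `ι τ₁ u = exp(M · L(ι τ₁ u))`, `F u = exp(Λ · L(ι τ₁ u))`.  Then
`F(u)^B = (ι τ₁ u)^A` for some `B ≥ 1`, `A ∈ ℤ` and all such `k` (six exponentials at three test
elements supported on non-`c`-stable degree-one primes). [cite: SerreAbelianLadic1968, Ch. III §3] -/
theorem anti_line (ιE : PadicAlgCl ℓ →+* E) (hι : ∀ x, ‖ιE x‖ = ‖x‖)
    (σ : 𝓞 K →+* 𝓞 K) (c : K →+* K) (hcσ : ∀ y : 𝓞 K, ((σ y : 𝓞 K) : K) = c (y : K))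
    (hσσ : ∀ y, σ (σ y) = y) {x₀ : 𝓞 K} (hx₀ : σ x₀ ≠ x₀) (τ₁ : K →+* PadicAlgCl ℓ)
    (anti : Kˣ → Kˣ) (hanti : ∀ k : Kˣ, ((anti k : Kˣ) : K) = (k : K) / c (k : K))
    (S : Finset (HeightOneSpectrum (𝓞 K))) {NS : ℕ} (hNS0 : NS ≠ 0)
    (hNS : ∀ w ∈ S, Ideal.absNorm w.asIdeal ∣ NS) (F : Kˣ →* E)
    (hFalg : ∀ u : Kˣ, (∀ w ∈ S, (ℓ : 𝓞 K) ∉ w.asIdeal → w.valuation K (u : K) = 1) →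
      IsAlgebraic ℤ (F u))
    {s : ℕ} (hs : 2 ≤ s) (Λm Mm : E)
    (hline : ∀ k : Kˣ, (∀ v : HeightOneSpectrum (𝓞 K), (ℓ : 𝓞 K) ∈ v.asIdeal →
        v.valuation K ((k : K) - 1) ≤ v.valuation K ((ℓ : K) ^ s)) →
      ‖Mm * ∑' m : ℕ, -((1 - ιE (τ₁ (anti k : K))) ^ (m + 1)) / (m + 1 : E)‖ < (ℓ : ℝ)⁻¹ ∧
      ‖Λm * ∑' m : ℕ, -((1 - ιE (τ₁ (anti k : K))) ^ (m + 1)) / (m + 1 : E)‖ < (ℓ : ℝ)⁻¹ ∧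
      ιE (τ₁ (anti k : K)) =
        exp (Mm * ∑' m : ℕ, -((1 - ιE (τ₁ (anti k : K))) ^ (m + 1)) / (m + 1 : E)) ∧
      F (anti k) = exp (Λm * ∑' m : ℕ, -((1 - ιE (τ₁ (anti k : K))) ^ (m + 1)) / (m + 1 : E))) :
    ∃ B : ℕ, 0 < B ∧ ∃ A : ℤ, ∀ k : Kˣ, (∀ v : HeightOneSpectrum (𝓞 K), (ℓ : 𝓞 K) ∈ v.asIdeal →
        v.valuation K ((k : K) - 1) ≤ v.valuation K ((ℓ : K) ^ s)) →
      F (anti k) ^ B = (ιE (τ₁ (anti k : K))) ^ A := by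
  classical
  haveI : CharZero E := charZero_of_injective_algebraMap (algebraMap ℚ_[ℓ] E).injective
  have hp : ℓ.Prime := Fact.out
  set q₀ : ℝ := (ℓ : ℝ)⁻¹ with hq₀def
  have hq0 : 0 < q₀ := inv_pos.mpr (by exact_mod_cast hp.pos)
  have hq1 : q₀ < 1 := inv_lt_one_of_one_lt₀ (by exact_mod_cast hp.one_lt)
  have hq2 : q₀ ≤ 1 / 2 := by
    rw [hq₀def, one_div]; exact inv_anti₀ two_pos (by exact_mod_cast hp.two_le)
  -- ### test elements at depth `s' ≥ s`
  have htest : ∀ s' : ℕ, s ≤ s' → ∃ (kk : Fin 3 → Kˣ) (𝔭 : Fin 3 → HeightOneSpectrum (𝓞 K)),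
      (∀ j, ∀ v : HeightOneSpectrum (𝓞 K), (ℓ : 𝓞 K) ∈ v.asIdeal →
        v.valuation K ((kk j : K) - 1) ≤ v.valuation K ((ℓ : K) ^ s')) ∧
      (∀ j, ∀ w ∈ S, (ℓ : 𝓞 K) ∉ w.asIdeal → w.valuation K ((anti (kk j) : Kˣ) : K) = 1) ∧
      (∀ i j, (𝔭 i).valuation K ((anti (kk j) : Kˣ) : K) = (𝔭 i).valuation K (kk j : K)) ∧
      (∀ i j, i ≠ j → (𝔭 i).valuation K (kk j : K) = 1) ∧
      (∀ j, (𝔭 j).valuation K (kk j : K) < 1) := by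
    intro s' hss'
    have hC₀ : ℓ ^ s' * NS ≠ 0 := mul_ne_zero (pow_ne_zero _ hp.ne_zero) hNS0
    obtain ⟨x, 𝔭, hσx, hxij, hxj⟩ := exists_test_elements σ hσσ hx₀ hC₀
    -- the integers `1 + C₀ xⱼ` and their conjugates
    have hform : ∀ j, ((1 + ((ℓ ^ s' * NS : ℕ) : 𝓞 K) * x j : 𝓞 K) : K) =
        (((1 + (NS : 𝓞 K) * (((ℓ ^ s' : ℕ) : 𝓞 K) * x j) : 𝓞 K)) : K) := by
      intro j; push_cast; ring
    have hformσ : ∀ j, ((σ (1 + ((ℓ ^ s' * NS : ℕ) : 𝓞 K) * x j) : 𝓞 K) : K) =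
        (((1 + (NS : 𝓞 K) * (((ℓ ^ s' : ℕ) : 𝓞 K) * σ (x j)) : 𝓞 K)) : K) := by
      intro j
      rw [map_add, map_one, map_mul, map_natCast]
      push_cast; ring
    have hne0 : ∀ j, ((1 + ((ℓ ^ s' * NS : ℕ) : 𝓞 K) * x j : 𝓞 K) : K) ≠ 0 := by
      intro j h0
      have h1 : (1 + ((ℓ ^ s' * NS : ℕ) : 𝓞 K) * x j : 𝓞 K) = 0 := by exact_mod_cast h0
      apply hσx j j
      rw [h1, map_zero]
      exact (𝔭 j).asIdeal.zero_mem
    set kk : Fin 3 → Kˣ := fun j => Units.mk0 _ (hne0 j) with hkkdef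
    have hkkval : ∀ j, ((kk j : Kˣ) : K) = ((1 + ((ℓ ^ s' * NS : ℕ) : 𝓞 K) * x j : 𝓞 K) : K) :=
      fun j => rfl
    have hckk : ∀ j, c ((kk j : Kˣ) : K) = ((σ (1 + ((ℓ ^ s' * NS : ℕ) : 𝓞 K) * x j) : 𝓞 K) : K) := by
      intro j; rw [hkkval, ← hcσ]
    refine ⟨kk, 𝔭, fun j => ?_, fun j w hw _ => ?_, fun i j => ?_, fun i j hij => ?_, fun j => ?_⟩
    · -- congruence
      have e : ((kk j : Kˣ) : K) - 1 = (ℓ : K) ^ s' * (((NS : 𝓞 K) * x j : 𝓞 K) : K) := by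
        rw [hkkval]; push_cast; ring
      rw [e]
      have := Cong.mul (Cong.pow_self (K := K) (ℓ := ℓ) s') (Cong.zero_coe (K := K) (ℓ := ℓ) ((NS : 𝓞 K) * x j))
      rwa [add_zero] at this
    · -- unit at `w ∈ S`
      rw [hanti, map_div₀, hckk, hkkval, hform, hformσ, valuation_one_add_mul_eq_one (hNS w hw),
        valuation_one_add_mul_eq_one (hNS w hw), div_one]
    · -- `|anti kⱼ|_{𝔭ᵢ} = |kⱼ|_{𝔭ᵢ}`
      rw [hanti, map_div₀, hckk]
      have : (𝔭 i).valuation K (((σ (1 + ((ℓ ^ s' * NS : ℕ) : 𝓞 K) * x j) : 𝓞 K)) : K) = 1 := by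
        rw [show (((σ (1 + ((ℓ ^ s' * NS : ℕ) : 𝓞 K) * x j) : 𝓞 K)) : K) =
          algebraMap (𝓞 K) K (σ (1 + ((ℓ ^ s' * NS : ℕ) : 𝓞 K) * x j)) from rfl,
          valuation_eq_one_iff_notMem]
        exact hσx i j
      rw [this, div_one]
    · rw [hkkval, show (((1 + ((ℓ ^ s' * NS : ℕ) : 𝓞 K) * x j : 𝓞 K)) : K) =
        algebraMap (𝓞 K) K (1 + ((ℓ ^ s' * NS : ℕ) : 𝓞 K) * x j) from rfl,
        valuation_eq_one_iff_notMem]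
      exact hxij i j hij
    · rw [hkkval]
      exact ((𝔭 j).valuation_lt_one_iff_mem _).mpr (hxj j)
  -- ### the dichotomy
  by_cases hli : ¬ LinearIndependent ℤ ![Mm, Λm]
  · rw [LinearIndependent.pair_iff] at hli
    push Not at hli
    obtain ⟨a, b, hrel, hab⟩ := hli
    have hline' : ∀ k : Kˣ, (∀ v : HeightOneSpectrum (𝓞 K), (ℓ : 𝓞 K) ∈ v.asIdeal →
        v.valuation K ((k : K) - 1) ≤ v.valuation K ((ℓ : K) ^ s)) →
        (ιE (τ₁ (anti k : K))) ^ a * F (anti k) ^ b = 1 := by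
      intro k hk
      obtain ⟨h1, h2, h3, h4⟩ := hline k hk
      conv_lhs => rw [h3, h4]
      exact exp_zpow_mul_exp_zpow_eq_one (ℓ := ℓ) hrel h1 h2
    -- `b ≠ 0`: test with `k₁` at depth `s`
    have hb : b ≠ 0 := by
      intro hb0
      have ha0 : a ≠ 0 := fun h => hab h hb0
      obtain ⟨kk, 𝔭, hkc, -, hval, -, hlt⟩ := htest s le_rfl
      have h1 := hline' (kk 0) (hkc 0)
      rw [hb0, zpow_zero, mul_one, ← map_zpow₀, ← map_zpow₀, ← map_one ιE, ← map_one τ₁] at h1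
      have h2 : ((anti (kk 0) : Kˣ) : K) ^ a = 1 := τ₁.injective (ιE.injective h1)
      have h3 := congrArg ((𝔭 0).valuation K) h2
      rw [map_zpow₀, hval, Valuation.map_one] at h3
      -- `|k₀|^a = 1` with `|k₀| < 1`
      have hx0 : (𝔭 0).valuation K (kk 0 : K) ≠ 0 := (Valuation.ne_zero_iff _).mpr (kk 0).ne_zero
      rcases lt_or_gt_of_ne ha0 with hneg | hpos
      · have h4 : (𝔭 0).valuation K (kk 0 : K) ^ (-a).toNat = (𝔭 0).valuation K (kk 0 : K) ^ 0 := by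
          rw [pow_zero, ← zpow_natCast, Int.toNat_of_nonneg (by omega), zpow_neg, h3, inv_one]
        have := pow_injective_of_lt_one hx0 (hlt 0) h4
        omega
      · have h4 : (𝔭 0).valuation K (kk 0 : K) ^ a.toNat = (𝔭 0).valuation K (kk 0 : K) ^ 0 := by
          rw [pow_zero, ← zpow_natCast, Int.toNat_of_nonneg hpos.le, h3]
        have := pow_injective_of_lt_one hx0 (hlt 0) h4
        omega
    rcases lt_or_gt_of_ne hb with hneg | hpos
    · refine ⟨(-b).toNat, by omega, a, fun k hk => ?_⟩
      have h2 : F (anti k) ^ b = ((ιE (τ₁ (anti k : K))) ^ a)⁻¹ :=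
        eq_inv_of_mul_eq_one_right (hline' k hk)
      have e : (((-b).toNat : ℕ) : ℤ) = -b := Int.toNat_of_nonneg (by omega)
      rw [← zpow_natCast, e, zpow_neg, h2, inv_inv]
    · refine ⟨b.toNat, by omega, -a, fun k hk => ?_⟩
      have h2 : F (anti k) ^ b = ((ιE (τ₁ (anti k : K))) ^ a)⁻¹ :=
        eq_inv_of_mul_eq_one_right (hline' k hk)
      have e : ((b.toNat : ℕ) : ℤ) = b := Int.toNat_of_nonneg hpos.le
      rw [← zpow_natCast, e, h2, zpow_neg]
  · -- ### independent: six exponentials at the test elements of depth `s + t + 1`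
    exfalso
    push Not at hli
    refine not_linearIndependent_of_exp_isAlgebraic (ℓ := ℓ) ![Mm, Λm] (fun t => ?_) hli
    set s' : ℕ := s + t + 1 with hs'
    obtain ⟨kk, 𝔭, hkc, hunit, hval, hval1, hlt⟩ := htest s' (by omega)
    have hkcs : ∀ j, ∀ v : HeightOneSpectrum (𝓞 K), (ℓ : 𝓞 K) ∈ v.asIdeal →
        v.valuation K ((kk j : K) - 1) ≤ v.valuation K ((ℓ : K) ^ s) :=
      fun j => Cong.mono (hkc j) (by omega)
    -- congruence of the anti-invariant elements
    have hantic : ∀ j, ∀ v : HeightOneSpectrum (𝓞 K), (ℓ : 𝓞 K) ∈ v.asIdeal →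
        v.valuation K (((anti (kk j) : Kˣ) : K) - 1) ≤ v.valuation K ((ℓ : K) ^ s') := by
      intro j
      rw [hanti]
      exact cong_div_sub_one (by omega) (hkc j) (cong_map_sub_one c (hkc j))
    have hnorm1 : ∀ j, ‖1 - ιE (τ₁ ((anti (kk j) : Kˣ) : K))‖ ≤ q₀ ^ s' := by
      intro j
      rw [← map_one ιE, ← map_sub, hι, ← map_one τ₁, ← map_sub, ← neg_sub, map_neg, norm_neg]
      exact Expansion.norm_embedding_le_of_cong (hantic j) τ₁
    have hs'2 : 2 ≤ s' := by omega
    have hqs'4 : q₀ ^ s' ≤ 1 / 4 := by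
      calc q₀ ^ s' ≤ q₀ ^ 2 := pow_le_pow_of_le_one hq0.le hq1.le hs'2
        _ ≤ (1 / 2) ^ 2 := pow_le_pow_left₀ hq0.le hq2 2
        _ = 1 / 4 := by norm_num
    have hqs'1 : q₀ ^ s' < 1 := pow_lt_one₀ hq0.le hq1 (by omega)
    set y : Fin 3 → E := fun j =>
      ∑' m : ℕ, -((1 - ιE (τ₁ ((anti (kk j) : Kˣ) : K))) ^ (m + 1)) / (m + 1 : E) with hydef
    refine ⟨y, ?_, fun j => ?_, fun i j => ?_⟩
    · -- independence of `y`
      rw [Fintype.linearIndependent_iff]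
      intro g hg j0
      set kp : Fin 3 → ℕ := fun j => (g j).toNat with hkp
      set kn : Fin 3 → ℕ := fun j => (-g j).toNat with hkn
      have hk_eq : ∀ j, (g j : ℤ) = kp j - kn j := fun j => by simp only [hkp, hkn]; omega
      have hprin : ∀ j, ‖1 - ιE (τ₁ ((anti (kk j) : Kˣ) : K))‖ < 1 := fun j =>
        (hnorm1 j).trans_lt hqs'1
      have hLA := LogE.logSeries_prod_pow (ℓ := ℓ) Finset.univ
        (fun j => ιE (τ₁ ((anti (kk j) : Kˣ) : K))) kp (fun j _ => hprin j)
      have hLB := LogE.logSeries_prod_pow (ℓ := ℓ) Finset.univ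
        (fun j => ιE (τ₁ ((anti (kk j) : Kˣ) : K))) kn (fun j _ => hprin j)
      have hsum : ∑ j, ((kp j : E)) * y j = ∑ j, ((kn j : E)) * y j := by
        rw [← sub_eq_zero, ← Finset.sum_sub_distrib, ← hg]
        refine Finset.sum_congr rfl fun j _ => ?_
        rw [zsmul_eq_mul, hk_eq]; push_cast; ring
      have hLAB : (∑' m : ℕ, -((1 - ∏ j, ιE (τ₁ ((anti (kk j) : Kˣ) : K)) ^ kp j) ^ (m + 1)) /
          (m + 1 : E)) = ∑' m : ℕ, -((1 - ∏ j, ιE (τ₁ ((anti (kk j) : Kˣ) : K)) ^ kn j) ^ (m + 1)) /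
          (m + 1 : E) := by
        rw [hLA, hLB]; exact hsum
      have hAB : ∏ j, ιE (τ₁ ((anti (kk j) : Kˣ) : K)) ^ kp j =
          ∏ j, ιE (τ₁ ((anti (kk j) : Kˣ) : K)) ^ kn j :=
        LogE.eq_of_logSeries_eq (ℓ := ℓ)
          ((norm_one_sub_prod_pow_le _ _ _ (pow_nonneg hq0.le _) hqs'1 fun j _ => hnorm1 j).trans hqs'4)
          ((norm_one_sub_prod_pow_le _ _ _ (pow_nonneg hq0.le _) hqs'1 fun j _ => hnorm1 j).trans hqs'4)
          hLAB
      -- pull back to `K` and take `|·|_{𝔭_{j0}}`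
      have hK : ∏ j, ((anti (kk j) : Kˣ) : K) ^ kp j = ∏ j, ((anti (kk j) : Kˣ) : K) ^ kn j := by
        apply τ₁.injective
        apply ιE.injective
        simpa only [map_prod, map_pow] using hAB
      have hv := congrArg ((𝔭 j0).valuation K) hK
      rw [map_prod, map_prod] at hv
      simp only [map_pow, hval] at hv
      rw [Finset.prod_eq_single j0 (fun j _ hj => by rw [hval1 j0 j (Ne.symm hj), one_pow])
          (fun h => absurd (Finset.mem_univ j0) h),
        Finset.prod_eq_single j0 (fun j _ hj => by rw [hval1 j0 j (Ne.symm hj), one_pow])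
          (fun h => absurd (Finset.mem_univ j0) h)] at hv
      have hx0 : (𝔭 j0).valuation K (kk j0 : K) ≠ 0 := (Valuation.ne_zero_iff _).mpr (kk j0).ne_zero
      have := pow_injective_of_lt_one hx0 (hlt j0) hv
      rw [hk_eq j0]
      omega
    · -- smallness
      change ‖∑' m : ℕ, -((1 - ιE (τ₁ ((anti (kk j) : Kˣ) : K))) ^ (m + 1)) / (m + 1 : E)‖ ≤
        q₀ ^ (t + 1)
      rw [LogE.norm_logSeries_eq (ℓ := ℓ) ((hnorm1 j).trans hqs'4)]
      exact (hnorm1 j).trans (pow_le_pow_of_le_one hq0.le hq1.le (by omega))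
    · -- algebraicity
      obtain ⟨h1, h2, h3, h4⟩ := hline (kk j) (hkcs j)
      fin_cases i
      · change IsAlgebraic ℤ (exp (Mm * y j))
        rw [← h3]
        have halgK : IsAlgebraic ℤ ((anti (kk j) : Kˣ) : K) :=
          (IsFractionRing.isAlgebraic_iff ℤ ℚ K).mpr (Algebra.IsAlgebraic.isAlgebraic _)
        exact FramedGaloisRep.isAlgebraic_int_map (instA := Ring.toIntAlgebra K)
          (instB := Ring.toIntAlgebra E) (ιE.comp τ₁) halgK
      · change IsAlgebraic ℤ (exp (Λm * y j))
        rw [← h4]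
        exact hFalg _ (hunit j)

end Quadratic

end Literature.NumberTheory.GaloisRepresentations

/-! ### B5. Böckle–Hui Thm. 2.2 over quadratic fields, in the idelic rendering -/

namespace Literature.NumberTheory.GaloisRepresentations

namespace Quadratic

open scoped NumberField
open NumberField IsDedekindDomain IsDedekindDomain.HeightOneSpectrum Filter Topology Finset NormedSpace Field
open Literature.NumberTheory.Transcendental

variable {K : Type} [Field K] [NumberField K] {ℓ : ℕ} [Fact ℓ.Prime]

/-- **Böckle–Hui Thm. 2.2 (Waldschmidt) for QUADRATIC number fields, in the idelic rendering of
`exists_heckeCharacter_of_weaklyDivides_of_thm22` (the hypothesis `h22` there), proved**: for a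
continuous `ψ : Γ_K → GL_1(ℚ̄_ℓ)` with idelic avatar `Ψ` and algebraic Frobenius values at almost all
places of a quadratic field `K`, some power identity
`(∏_{v∣ℓ} Ψ(⟨k⟩_v))^N = ∏_τ τ(k)^{-n_τ}` holds for all `k ≡ 1 mod 𝔭_v^m` (`v ∣ ℓ`).  Proof: the
analytic expansion (`Expansion.exists_expansion`), the rational line and the anti-invariant line
(`rational_line`, `anti_line`: the `ℓ`-adic six exponentials theorem along the two
`±1`-eigendirections of `Gal(K/ℚ) = {1, c}` realised by `k ↦ k c(k) ∈ ℚ` and `k ↦ k / c(k)`), and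
`k² = N(k) · k/c(k)`.  This is Serre's theorem (*Abelian ℓ-adic representations*, Ch. III §3.4:
"`K` a composite of quadratic fields") in the quadratic case.
[cite: SerreAbelianLadic1968, Ch. III §3] [cite: BockleHui2025, Theorem 2.2 (quadratic `K`)] -/
theorem pow_isLocallyAlgebraic_of_frobenius_isAlgebraic_quadratic [Algebra.IsQuadraticExtension ℚ K]
    (ψ : FramedGaloisRep K (PadicAlgCl ℓ) 1) (Ψ : ideleGroup K →ₜ* (PadicAlgCl ℓ)ˣ)
    (hK : ∀ x ∈ principalIdeles K, Ψ x = 1)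
    (hΨ : ∀ᶠ v : HeightOneSpectrum (𝓞 K) in cofinite, ψ.IsUnramifiedAt v ∧
      (∀ u : (v.adicCompletionIntegers K)ˣ,
          Ψ (localUnits v (Units.map ((v.adicCompletionIntegers K).subtype : _ →* _) u)) = 1) ∧
      ∀ ϖ : (v.adicCompletion K)ˣ, Valued.v (ϖ : v.adicCompletion K) = WithZero.exp (-1 : ℤ) →
        ψ.HasFrobCharpolyAt v
          (Polynomial.X - Polynomial.C ((Ψ (localUnits v ϖ) : (PadicAlgCl ℓ)ˣ) : PadicAlgCl ℓ)))
    (halg : ∀ᶠ v : HeightOneSpectrum (𝓞 K) in cofinite, ψ.IsUnramifiedAt v ∧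
      ∀ 𝔓 ∈ v.primesAbove, ∀ σ : absoluteGaloisGroup K, IsArithFrobAt (𝓞 K) σ 𝔓 →
        IsAlgebraic ℚ ((((ψ σ : GL (Fin 1) (PadicAlgCl ℓ)) :
          Matrix (Fin 1) (Fin 1) (PadicAlgCl ℓ)) 0 0)))
    (L : Finset (HeightOneSpectrum (𝓞 K))) (hL : ∀ v, v ∈ L ↔ (ℓ : 𝓞 K) ∈ v.asIdeal) :
    ∃ N : ℕ, 0 < N ∧ ∃ (n : (K →+* PadicAlgCl ℓ) → ℤ) (m : ℕ), ∀ k : Kˣ,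
      (∀ v ∈ L, Valued.v (algebraMap K (v.adicCompletion K) (k : K) - 1) ≤
          WithZero.exp (-(m : ℤ))) →
      (∏ v ∈ L, ((Ψ (localUnits v (globalToLocalUnits v k)) : (PadicAlgCl ℓ)ˣ) : PadicAlgCl ℓ)) ^ N =
        ∏ τ : K →+* PadicAlgCl ℓ, τ (k : K) ^ (-(n τ)) := by
  classical
  have hp : ℓ.Prime := Fact.out
  set q₀ : ℝ := (ℓ : ℝ)⁻¹ with hq₀def
  have hq0 : 0 < q₀ := inv_pos.mpr (by exact_mod_cast hp.pos)
  have hq1 : q₀ < 1 := inv_lt_one_of_one_lt₀ (by exact_mod_cast hp.one_lt)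
  -- ### Step 0: the exceptional set `S` and the algebraic values of `f = ∏_{v∈L} Ψ⟨·⟩_v`
  have hΨ' := hΨ
  have halg' := halg
  rw [Filter.eventually_cofinite] at hΨ' halg'
  set S : Finset (HeightOneSpectrum (𝓞 K)) := L ∪ hΨ'.toFinset ∪ halg'.toFinset with hSdef
  have hgoodΨ : ∀ w ∉ S, ψ.IsUnramifiedAt w ∧
      (∀ u : (w.adicCompletionIntegers K)ˣ,
          Ψ (localUnits w (Units.map ((w.adicCompletionIntegers K).subtype : _ →* _) u)) = 1) ∧
      ∀ ϖ : (w.adicCompletion K)ˣ, Valued.v (ϖ : w.adicCompletion K) = WithZero.exp (-1 : ℤ) →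
        ψ.HasFrobCharpolyAt w (Polynomial.X - Polynomial.C ((Ψ (localUnits w ϖ) :
          (PadicAlgCl ℓ)ˣ) : PadicAlgCl ℓ)) := by
    intro w hw
    by_contra hc
    exact hw (Finset.mem_union_left _ (Finset.mem_union_right _ (hΨ'.mem_toFinset.mpr hc)))
  have hgoodalg : ∀ w ∉ S, ψ.IsUnramifiedAt w ∧
      ∀ 𝔓 ∈ w.primesAbove, ∀ σ : absoluteGaloisGroup K, IsArithFrobAt (𝓞 K) σ 𝔓 →
        IsAlgebraic ℚ ((((ψ σ : GL (Fin 1) (PadicAlgCl ℓ)) :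
          Matrix (Fin 1) (Fin 1) (PadicAlgCl ℓ)) 0 0)) := by
    intro w hw
    by_contra hc
    exact hw (Finset.mem_union_right _ (halg'.mem_toFinset.mpr hc))
  have hS : ∀ w ∉ S, ∀ u : (w.adicCompletionIntegers K)ˣ,
      Ψ (localUnits w (Units.map ((w.adicCompletionIntegers K).subtype : _ →* _) u)) = 1 :=
    fun w hw => (hgoodΨ w hw).2.1
  have halgΨ : ∀ w ∉ S, IsAlgebraic ℚ
      ((Ψ (localUnits w (HeckeCharacter.uniformizer K w)) : (PadicAlgCl ℓ)ˣ) : PadicAlgCl ℓ) := by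
    intro w hw
    obtain ⟨𝔓, h𝔓⟩ := w.primesAbove_nonempty
    obtain ⟨Φ, hΦ⟩ := HeightOneSpectrum.exists_isArithFrobAt_of_mem_primesAbove_holds h𝔓
    have h1 := (FramedGaloisRep.hasFrobCharpolyAt_iff_of_rank_one ψ w _).mp
      ((hgoodΨ w hw).2.2 _ (HeckeCharacter.valued_uniformizer w)) 𝔓 h𝔓 Φ hΦ
    rw [← h1]
    exact (hgoodalg w hw).2 𝔓 h𝔓 Φ hΦ
  have hSfilter : S.filter (fun v => (ℓ : 𝓞 K) ∈ v.asIdeal) = L := by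
    ext v
    simp only [Finset.mem_filter, hSdef, Finset.mem_union]
    constructor
    · rintro ⟨-, hv⟩; exact (hL v).mpr hv
    · intro hv; exact ⟨Or.inl (Or.inl hv), (hL v).mp hv⟩
  -- the product `f` as a homomorphism
  set f : Kˣ →* (PadicAlgCl ℓ)ˣ :=
    ∏ v ∈ L, Ψ.toMonoidHom.comp ((localUnits v).comp (globalToLocalUnits (K := K) v)) with hfdef
  have hf : ∀ u : Kˣ, f u = ∏ v ∈ L, Ψ (localUnits v (globalToLocalUnits v u)) := by
    intro u; rw [hfdef, MonoidHom.finsetProd_apply]; rfl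
  have hfval : ∀ u : Kˣ, ((f u : (PadicAlgCl ℓ)ˣ) : PadicAlgCl ℓ) =
      ∏ v ∈ L, ((Ψ (localUnits v (globalToLocalUnits v u)) : (PadicAlgCl ℓ)ˣ) : PadicAlgCl ℓ) := by
    intro u; rw [hf, Units.coe_prod]
  have halgf : ∀ u : Kˣ, (∀ w ∈ S, (ℓ : 𝓞 K) ∉ w.asIdeal → w.valuation K (u : K) = 1) →
      IsAlgebraic ℚ ((f u : (PadicAlgCl ℓ)ˣ) : PadicAlgCl ℓ) := by
    intro u hu
    have := IdelicCharacter.isAlgebraic_prod_map_localUnits Ψ hK S hS halgΨ u hu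
    rwa [hSfilter, ← hf] at this
  -- the norm modulus `NS`
  set NS : ℕ := ∏ w ∈ S, Ideal.absNorm w.asIdeal with hNSdef
  have hNS0 : NS ≠ 0 := Finset.prod_ne_zero_iff.mpr fun w _ => by
    rw [Ne, Ideal.absNorm_eq_zero_iff]; exact w.ne_bot
  have hNS : ∀ w ∈ S, Ideal.absNorm w.asIdeal ∣ NS := fun w hw => Finset.dvd_prod_of_mem _ hw
  -- ### Step 1: the quadratic structure
  obtain ⟨c, hc1, hcc, hall⟩ := exists_aut (K := K)
  set τ₁ : K →+* PadicAlgCl ℓ := Classical.arbitrary _ with hτ₁def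
  obtain ⟨hτne, huniv⟩ := univ_eq_pair (ℓ := ℓ) hc1 τ₁
  set cK : K →+* K := (c : K →+* K) with hcKdef
  have hcK : ∀ x, cK x = c x := fun _ => rfl
  set τ₂ : K →+* PadicAlgCl ℓ := τ₁.comp cK with hτ₂def
  have hτ₂ : ∀ x, τ₂ x = τ₁ (c x) := fun _ => rfl
  have hsum2 : ∀ g : (K →+* PadicAlgCl ℓ) → ℂ_[ℓ], ∑ τ, g τ = g τ₁ + g τ₂ := by
    intro g; rw [huniv, Finset.sum_pair (Ne.symm hτne)]
  have hprod2 : ∀ g : (K →+* PadicAlgCl ℓ) → PadicAlgCl ℓ, ∏ τ, g τ = g τ₁ * g τ₂ := by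
    intro g; rw [huniv, Finset.prod_pair (Ne.symm hτne)]
  have hcc' : ∀ x : K, c (c x) = x := aut_aut hcc
  set σO : 𝓞 K →+* 𝓞 K := RingOfIntegers.mapRingHom cK with hσOdef
  have hσO : ∀ y : 𝓞 K, ((σO y : 𝓞 K) : K) = cK (y : K) := fun y => rfl
  have hσσ : ∀ y, σO (σO y) = y := by
    intro y; apply RingOfIntegers.ext; rw [hσO, hσO, hcK, hcK, hcc']
  -- an integer moved by `c`
  obtain ⟨x₀, hx₀⟩ : ∃ x₀ : 𝓞 K, σO x₀ ≠ x₀ := by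
    by_contra hcon
    push Not at hcon
    apply hc1
    ext x
    obtain ⟨a, d, -, rfl⟩ := IsFractionRing.div_surjective (A := 𝓞 K) x
    have ha : c (a : K) = a := by
      have := congrArg (fun w : 𝓞 K => (w : K)) (hcon a); rwa [hσO, hcK] at this
    have hd : c (d : K) = d := by
      have := congrArg (fun w : 𝓞 K => (w : K)) (hcon d); rwa [hσO, hcK] at this
    change c (algebraMap (𝓞 K) K a / algebraMap (𝓞 K) K d) = _
    rw [map_div₀, show algebraMap (𝓞 K) K a = (a : K) from rfl,
      show algebraMap (𝓞 K) K d = (d : K) from rfl, ha, hd, AlgEquiv.one_apply]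
  -- ### Step 2: the analytic expansion in `ℂ_ℓ`
  set ιE : PadicAlgCl ℓ →+* ℂ_[ℓ] := algebraMap (PadicAlgCl ℓ) ℂ_[ℓ] with hιEdef
  have hι : ∀ x, ‖ιE x‖ = ‖x‖ := fun x => by
    rw [hιEdef, ← PadicComplex.coe_eq]; exact PadicComplex.norm_extends ℓ x
  obtain ⟨s, hs2, lam, mu, hexp⟩ :=
    Expansion.exists_expansion Ψ ιE hι L (fun v hv => (hL v).mp hv) hq0
  -- `F = ι ∘ f`
  set F : Kˣ →* ℂ_[ℓ] := (ιE.toMonoidHom.comp (Units.coeHom (PadicAlgCl ℓ))).comp f with hFdef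
  have hF : ∀ u : Kˣ, F u = ιE ((f u : (PadicAlgCl ℓ)ˣ) : PadicAlgCl ℓ) := fun u => rfl
  have hFalg : ∀ u : Kˣ, (∀ w ∈ S, (ℓ : 𝓞 K) ∉ w.asIdeal → w.valuation K (u : K) = 1) →
      @IsAlgebraic ℤ ℂ_[ℓ] _ _ (Ring.toIntAlgebra _) (F u) := by
    intro u hu
    rw [hF]
    exact FramedGaloisRep.isAlgebraic_int_map (instA := Ring.toIntAlgebra _)
      (instB := Ring.toIntAlgebra _) ιE
      ((IsFractionRing.isAlgebraic_iff ℤ ℚ (PadicAlgCl ℓ)).mpr (halgf u hu))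
  -- the four coefficients
  set Λ : ℂ_[ℓ] := lam τ₁ + lam τ₂ with hΛ
  set Mp : ℂ_[ℓ] := mu τ₁ τ₁ + mu τ₁ τ₂ with hMp
  set Λm : ℂ_[ℓ] := lam τ₁ - lam τ₂ with hΛm
  set Mm : ℂ_[ℓ] := mu τ₁ τ₁ - mu τ₁ τ₂ with hMm
  -- ### Step 3: the rational line
  have hlineR : ∀ (q : ℚ) (hq : algebraMap ℚ K q ≠ 0),
      (∀ v : HeightOneSpectrum (𝓞 K), (ℓ : 𝓞 K) ∈ v.asIdeal →
        v.valuation K (algebraMap ℚ K q - 1) ≤ v.valuation K ((ℓ : K) ^ s)) →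
      ‖Mp * ∑' m : ℕ, -((1 - (q : ℂ_[ℓ])) ^ (m + 1)) / (m + 1 : ℂ_[ℓ])‖ < (ℓ : ℝ)⁻¹ ∧
      ‖Λ * ∑' m : ℕ, -((1 - (q : ℂ_[ℓ])) ^ (m + 1)) / (m + 1 : ℂ_[ℓ])‖ < (ℓ : ℝ)⁻¹ ∧
      (q : ℂ_[ℓ]) = exp (Mp * ∑' m : ℕ, -((1 - (q : ℂ_[ℓ])) ^ (m + 1)) / (m + 1 : ℂ_[ℓ])) ∧
      F (Units.mk0 _ hq) =
        exp (Λ * ∑' m : ℕ, -((1 - (q : ℂ_[ℓ])) ^ (m + 1)) / (m + 1 : ℂ_[ℓ])) := by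
    intro q hq hcq
    obtain ⟨-, hFn, hFe, hτ⟩ := hexp (Units.mk0 _ hq) hcq
    obtain ⟨hMn, hMe⟩ := hτ τ₁
    have hcast : ∀ τ : K →+* PadicAlgCl ℓ, ιE (τ ((Units.mk0 _ hq : Kˣ) : K)) = (q : ℂ_[ℓ]) := by
      intro τ; rw [Units.val_mk0, eq_ratCast, map_ratCast, map_ratCast]
    simp only [hcast] at hFn hFe hMn hMe
    rw [hsum2, ← add_mul] at hFn hFe
    rw [hsum2, ← add_mul] at hMn hMe
    refine ⟨hMn, hFn, hMe, ?_⟩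
    rw [hF, hfval]
    exact hFe
  obtain ⟨B₁, hB₁, A₁, hrat⟩ := rational_line (ℓ := ℓ) S hNS0 hNS F hFalg (by omega : 1 ≤ s) Λ Mp hlineR
  -- ### Step 4: the anti-invariant line
  have hck0 : ∀ k : Kˣ, c (k : K) ≠ 0 := fun k => (map_ne_zero c).mpr k.ne_zero
  set anti : Kˣ → Kˣ := fun k => Units.mk0 ((k : K) / c (k : K)) (div_ne_zero k.ne_zero (hck0 k))
    with hantidef
  have hanti : ∀ k : Kˣ, ((anti k : Kˣ) : K) = (k : K) / cK (k : K) := fun k => rfl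
  have hlineA : ∀ k : Kˣ, (∀ v : HeightOneSpectrum (𝓞 K), (ℓ : 𝓞 K) ∈ v.asIdeal →
        v.valuation K ((k : K) - 1) ≤ v.valuation K ((ℓ : K) ^ s)) →
      ‖Mm * ∑' m : ℕ, -((1 - ιE (τ₁ (anti k : K))) ^ (m + 1)) / (m + 1 : ℂ_[ℓ])‖ < (ℓ : ℝ)⁻¹ ∧
      ‖Λm * ∑' m : ℕ, -((1 - ιE (τ₁ (anti k : K))) ^ (m + 1)) / (m + 1 : ℂ_[ℓ])‖ < (ℓ : ℝ)⁻¹ ∧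
      ιE (τ₁ (anti k : K)) =
        exp (Mm * ∑' m : ℕ, -((1 - ιE (τ₁ (anti k : K))) ^ (m + 1)) / (m + 1 : ℂ_[ℓ])) ∧
      F (anti k) = exp (Λm * ∑' m : ℕ, -((1 - ιE (τ₁ (anti k : K))) ^ (m + 1)) / (m + 1 : ℂ_[ℓ])) := by
    intro k hk
    have hak : ∀ v : HeightOneSpectrum (𝓞 K), (ℓ : 𝓞 K) ∈ v.asIdeal →
        v.valuation K (((anti k : Kˣ) : K) - 1) ≤ v.valuation K ((ℓ : K) ^ s) := by
      rw [hanti]; exact cong_div_sub_one (by omega) hk (cong_map_sub_one cK hk)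
    obtain ⟨h1, hFn, hFe, hτ⟩ := hexp (anti k) hak
    obtain ⟨hMn, hMe⟩ := hτ τ₁
    -- `τ₂ (anti k) = (τ₁ (anti k))⁻¹`
    have hτ₂a : ιE (τ₂ ((anti k : Kˣ) : K)) = (ιE (τ₁ ((anti k : Kˣ) : K)))⁻¹ := by
      rw [hτ₂, hanti, hcK, map_div₀, hcc', map_div₀, map_div₀, map_div₀, map_div₀, inv_div]
    have hL₂ : (∑' m : ℕ, -((1 - ιE (τ₂ ((anti k : Kˣ) : K))) ^ (m + 1)) / (m + 1 : ℂ_[ℓ])) =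
        -∑' m : ℕ, -((1 - ιE (τ₁ ((anti k : Kˣ) : K))) ^ (m + 1)) / (m + 1 : ℂ_[ℓ]) := by
      rw [hτ₂a]
      exact LogE.logSeries_inv (ℓ := ℓ) ((h1 τ₁).trans_lt (pow_lt_one₀ hq0.le hq1 (by omega)))
    rw [hsum2, hL₂, mul_neg, ← sub_eq_add_neg, ← sub_mul] at hFn hFe hMn hMe
    refine ⟨hMn, hFn, hMe, ?_⟩
    rw [hF, hfval]
    exact hFe
  obtain ⟨B₂, hB₂, A₂, hant⟩ := anti_line (ℓ := ℓ) ιE hι σO cK hσO hσσ hx₀ τ₁ anti hanti S hNS0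
    hNS F hFalg hs2 Λm Mm hlineA
  -- ### Step 5: the level `m` and the combination `k² = N(k) · (k / c k)`
  have hM : ∀ v : HeightOneSpectrum (𝓞 K), ∃ M : ℕ, v.valuation K (ℓ : K) = WithZero.exp (-(M : ℤ)) := by
    intro v
    have hne : (ℓ : 𝓞 K) ≠ 0 := by exact_mod_cast hp.ne_zero
    refine ⟨(Associates.mk v.asIdeal).count (Associates.mk (Ideal.span {(ℓ : 𝓞 K)})).factors, ?_⟩
    rw [show (ℓ : K) = algebraMap (𝓞 K) K (ℓ : 𝓞 K) by simp, valuation_of_algebraMap,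
      v.intValuation_if_neg hne]
  choose Mv hMv using hM
  set m : ℕ := s * L.sup Mv with hmdef
  set e₁ : ℤ := A₁ * B₂ + A₂ * B₁ with he₁
  set e₂ : ℤ := A₁ * B₂ - A₂ * B₁ with he₂
  refine ⟨2 * B₁ * B₂, by positivity, fun τ => if τ = τ₁ then -e₁ else -e₂, m, fun k hk => ?_⟩
  -- the congruence `k ≡ 1 [ℓ^s]`
  have hkc : ∀ v : HeightOneSpectrum (𝓞 K), (ℓ : 𝓞 K) ∈ v.asIdeal →
      v.valuation K ((k : K) - 1) ≤ v.valuation K ((ℓ : K) ^ s) := by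
    intro v hv
    have hvL : v ∈ L := (hL v).mpr hv
    have h1 := hk v hvL
    rw [← map_one (algebraMap K (v.adicCompletion K)), ← map_sub, valued_algebraMap_adicCompletion]
      at h1
    refine h1.trans ?_
    rw [Valuation.map_pow, hMv v, ← WithZero.exp_nsmul, WithZero.exp_le_exp, nsmul_eq_mul]
    have := Finset.le_sup (f := Mv) hvL
    have : (s : ℤ) * (Mv v : ℤ) ≤ (m : ℤ) := by
      rw [hmdef]; push_cast; exact mul_le_mul_of_nonneg_left (by exact_mod_cast this) (by positivity)
    linarith
  -- the rational element `N(k) = k c(k)`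
  obtain ⟨qN, hqN⟩ := exists_algebraMap_eq_mul_aut hcc hall (k : K)
  have hqN0 : algebraMap ℚ K qN ≠ 0 := by rw [hqN]; exact mul_ne_zero k.ne_zero (hck0 k)
  have hNc : ∀ v : HeightOneSpectrum (𝓞 K), (ℓ : 𝓞 K) ∈ v.asIdeal →
      v.valuation K (algebraMap ℚ K qN - 1) ≤ v.valuation K ((ℓ : K) ^ s) := by
    rw [hqN]; exact cong_mul_sub_one hkc (cong_map_sub_one cK hkc)
  have hR := hrat qN hqN0 hNc
  have hA := hant k hkc
  -- `k² = N(k) · anti k` in `Kˣ`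
  have hsq : k ^ 2 = Units.mk0 _ hqN0 * anti k := by
    apply Units.ext
    rw [Units.val_pow_eq_pow_val, Units.val_mul, Units.val_mk0, hanti, hqN, hcK]
    field_simp
  -- `F(k)^{2 B₁ B₂}` computed
  have hι₁ : ιE (τ₁ (k : K)) ≠ 0 := (map_ne_zero ιE).mpr ((map_ne_zero τ₁).mpr k.ne_zero)
  have hι₂ : ιE (τ₂ (k : K)) ≠ 0 := (map_ne_zero ιE).mpr ((map_ne_zero τ₂).mpr k.ne_zero)
  have hqcast : (qN : ℂ_[ℓ]) = ιE (τ₁ (k : K)) * ιE (τ₂ (k : K)) := by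
    have : ιE (τ₁ (algebraMap ℚ K qN)) = (qN : ℂ_[ℓ]) := by rw [eq_ratCast, map_ratCast, map_ratCast]
    rw [← this, hqN, map_mul, map_mul, hτ₂]
  have hacast : ιE (τ₁ ((anti k : Kˣ) : K)) = ιE (τ₁ (k : K)) / ιE (τ₂ (k : K)) := by
    rw [hanti, hcK, map_div₀, map_div₀, hτ₂]
  have hFk : F k ^ (2 * B₁ * B₂) = ιE (τ₁ (k : K)) ^ e₁ * ιE (τ₂ (k : K)) ^ e₂ := by
    have h1 : F k ^ 2 = F (Units.mk0 _ hqN0) * F (anti k) := by rw [← map_pow, hsq, map_mul]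
    calc F k ^ (2 * B₁ * B₂) = (F k ^ 2) ^ (B₁ * B₂) := by rw [← pow_mul, mul_assoc]
      _ = (F (Units.mk0 _ hqN0) ^ B₁) ^ B₂ * (F (anti k) ^ B₂) ^ B₁ := by
          rw [h1, mul_pow, ← pow_mul, ← pow_mul, mul_comm B₂ B₁]
      _ = (((qN : ℂ_[ℓ])) ^ A₁) ^ B₂ * ((ιE (τ₁ ((anti k : Kˣ) : K))) ^ A₂) ^ B₁ := by rw [hR, hA]
      _ = ιE (τ₁ (k : K)) ^ e₁ * ιE (τ₂ (k : K)) ^ e₂ := by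
          rw [hqcast, hacast, he₁, he₂, ← zpow_natCast, ← zpow_natCast, ← zpow_mul, ← zpow_mul,
            mul_zpow, div_zpow, zpow_add₀ hι₁, zpow_sub₀ hι₂]
          field_simp
  -- back to `ℚ̄_ℓ`
  have hfk : ((f k : (PadicAlgCl ℓ)ˣ) : PadicAlgCl ℓ) ^ (2 * B₁ * B₂) =
      τ₁ (k : K) ^ e₁ * τ₂ (k : K) ^ e₂ := by
    apply ιE.injective
    rw [map_pow, ← hF, hFk, map_mul, map_zpow₀, map_zpow₀]
  rw [← hfval, hfk, hprod2]
  simp only [if_true, if_neg (show τ₂ ≠ τ₁ from hτne), neg_neg]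

end Quadratic

end Literature.NumberTheory.GaloisRepresentations

/-! ### Böckle–Hui Thm. 1.1 (characters) for quadratic fields, unconditional -/

namespace Literature.NumberTheory.GaloisRepresentations

open scoped NumberField Polynomial
open NumberField IsDedekindDomain Field Filter Polynomial

/-- **Böckle–Hui 2025, Thm. 1.1 for characters over QUADRATIC number fields (Hecke form of the
named fact `exists_heckeCharacter_of_weaklyDivides`), proved unconditionally**: a character
`ψ : Γ_K → GL_1(ℚ̄_ℓ)` weakly dividing an `E`-rational `ρ` over a quadratic field `K` comes from an
algebraic Hecke character.  (The named fact for all `K` follows from BH Thm. 2.2 in general,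
`exists_heckeCharacter_of_weaklyDivides_of_thm22`; here Thm. 2.2 is the proved
`Quadratic.pow_isLocallyAlgebraic_of_frobenius_isAlgebraic_quadratic`.)
[cite: BockleHui2025, Theorem 1.1 (quadratic `K`)] [cite: SerreAbelianLadic1968, Ch. III §3] -/
theorem exists_heckeCharacter_of_weaklyDivides_quadratic (K : Type) [Field K] [NumberField K]
    [Algebra.IsQuadraticExtension ℚ K] (ℓ : ℕ) [Fact ℓ.Prime] (n : ℕ)
    (E : Type) [Field E] [NumberField E] (e : E →+* PadicAlgCl ℓ)
    (ρ : FramedGaloisRep K (PadicAlgCl ℓ) n) (hρ : ρ.IsRationalOver e)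
    (ψ : FramedGaloisRep K (PadicAlgCl ℓ) 1) (h : ψ.WeaklyDivides ρ) (ι : PadicAlgCl ℓ ≃+* ℂ) :
    ∃ χ : HeckeCharacter K, χ.IsAlgebraic ∧
      ∀ᶠ v : HeightOneSpectrum (𝓞 K) in cofinite, χ.IsUnramifiedAt v ∧ ψ.IsUnramifiedAt v ∧
        ψ.HasFrobCharpolyAt v (X - C (ι.symm (χ.valueAtUniformizer v)⁻¹)) := by
  classical
  obtain ⟨Ψ, hK, hΨ⟩ := ψ.exists_idelicCharacter_eventually
  have hfin : {v : HeightOneSpectrum (𝓞 K) | (ℓ : 𝓞 K) ∈ v.asIdeal}.Finite := by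
    have hne : (Ideal.span {(ℓ : 𝓞 K)} : Ideal (𝓞 K)) ≠ ⊥ := by
      rw [Ne, Ideal.span_singleton_eq_bot, Nat.cast_eq_zero]
      exact (Fact.out : ℓ.Prime).ne_zero
    refine (Ideal.finite_factors hne).subset fun v hv => ?_
    simp only [Set.mem_setOf_eq] at hv ⊢
    exact (Ideal.dvd_span_singleton).mpr hv
  set L : Finset (HeightOneSpectrum (𝓞 K)) := hfin.toFinset with hLdef
  have hL : ∀ v, v ∈ L ↔ (ℓ : 𝓞 K) ∈ v.asIdeal := fun v => hfin.mem_toFinset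
  have halg : ∀ᶠ v : HeightOneSpectrum (𝓞 K) in cofinite, ψ.IsUnramifiedAt v ∧
      ∀ 𝔓 ∈ v.primesAbove, ∀ σ : absoluteGaloisGroup K, IsArithFrobAt (𝓞 K) σ 𝔓 →
        IsAlgebraic ℚ ((((ψ σ : GL (Fin 1) (PadicAlgCl ℓ)) :
          Matrix (Fin 1) (Fin 1) (PadicAlgCl ℓ)) 0 0)) :=
    (FramedGaloisRep.WeaklyDivides.eventually_isAlgebraic e hρ h).mono fun v hv => ⟨hv.2.1, hv.2.2⟩
  obtain ⟨N, hN, nn, m, hLA⟩ :=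
    Quadratic.pow_isLocallyAlgebraic_of_frobenius_isAlgebraic_quadratic ψ Ψ hK hΨ halg L hL
  exact FramedGaloisRep.WeaklyDivides.exists_heckeCharacter_of_almostLocAlg e hρ h Ψ hK hΨ L hL hN
    nn m hLA ι

end Literature.NumberTheory.GaloisRepresentations
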